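import Literature.MathematicalPhysics.QuantumFieldTheory.Balaban1983to89.T4TwoRunClosure
import Literature.MathematicalPhysics.QuantumFieldTheory.Balaban1983to89.T4FlagMemoryAF

/-!
# `Balaban1983to89.T4TwoRunAfTail` — node U2 / estimate NE4 by the TWO-RUN closure (technique P2), FED RUN-WISE:
step-dependent memory constants along the actual runs of (0.20), the step-indexed resolvent that closes them, and the
ORIENTATION of the asymptotic-freedom tail (the exceptional steps sit at the INFRARED end; only their number / their
coupling sum enters, and both are K-uniform).  Kernel bookkeeping over the hypothesis shapes of `T4FlagMemory`,
`T4FlagMemoryAF` (lineage t4-ne4-p1) and `T4TwoRunMatching` / `T4TwoRunClosure` (this lineage); nothing about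
Bałaban's objects is asserted.

HONEST FRAMING (cell `pub-balaban`, T4-DAG PAGE 1).  The cell's T4 target is rung (B)+1 of its ladder — existence AND
uniqueness of the ε → 0 limit of Bałaban's unit-scale expectations on a FIXED FINITE four-torus; NOT infinite volume,
NOT the Yang–Mills mass gap, NOT the Clay problem.  This module ASSERTS NOTHING about Bałaban's β-functions, effective
actions or renormalization transformations: the one-step scheme `Φ`, its read-out `r` and the one-step shapes
`StepDirect` / `StepShift` / `ReadLipschitz` / `Represents` (`T4FlagMemory` §2) and the coupling-weighted memory
`T4FlagMemoryAF.StepMemoryFn Φ γ (c·) ω` are HYPOTHESES, each NOT PRINTED (cell cross-reads `t4/T4-XREAD-U2.md` §3,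
`t4/T4-XREAD-U2R2.md` (N1)–(N4); GAPS G-t4-U2-1/2, G-t4-U2R-1…4, G-ne4p1-1…4, G-ne4p2-1…4); the runs of the printed
recursion (0.20) in the box ]0,γ] and their infrared pin are BINDERS (node U1/H3 of the spine); the eventual lower
bound `T4CouplingMatching.EventualLowerH b γ k₀ β` is the β sub-cell's (AF-0r)/tail-lower shape, a BINDER, NOT
discharged for Bałaban's β.  Every theorem is elementary real-variable bookkeeping.  Value = node U2's ledger with the
memory constant of the box, `cγ`, REMOVED FROM THE RATE GAP (it enters a K-uniform envelope constant instead); NOT an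
estimate on Bałaban's (2.13), NOT summit progress.

CITATION HEADER (lean-in-tree rule 2026-08-18).  T. Bałaban, *Renormalization group approach to lattice gauge field
theories. I*, Commun. Math. Phys. **109** (1987) 249–301 [Balaban1987RG1] (cell paper B12 = [I]; journal page = PDF
page + 248); T. Bałaban, *Renormalization group approach to lattice gauge field theories. II. Cluster expansions*,
Commun. Math. Phys. **116** (1988) 1–22 [Balaban1988RG2Cluster].  Both manuscripts are UNDER ADJUDICATION: quoted for
what they STATE, never as establishing a disputed step.  NOTHING IS NEWLY QUOTED in this module.  The loci behind the
hypothesis shapes — [I] p. 256 (0.20) "1/g_k² = 1/g²_{k+1} + β_{k+1}(g_k)" with "ε = L^{−K}, and the sequence of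
actions and coupling constants is defined for k = 0, 1, …, K", p. 259 (0.31) (asymptotic freedom of the running
coupling) and Theorem 2 (the infrared pin `g_K = g`), p. 268 (2.12)–(2.15) (the new term as a function of g_k and of
the previous action); [II] p. 8 (1.29) and «Another possibility is to use the expression g_k|B| instead of ε₁. It
gives a better bound», p. 9 Lemma 1 (1.36) — are quoted VERBATIM, with the renders named, in the headers of
`T4TwoRunMatching`, `T4FlagMemory`, `T4FlagMemoryTwoRun`, `T4FlagMemoryAF` and `T4CouplingMatching`; the [cite:] tags
below repeat those loci for the STRUCTURAL sentences they formalise and claim nothing more.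

THE POINT (cell T4-DAG §5 NE4 rows; GAPS G-ne4p1-4 names this lineage's two-run closure as the consumer to be "fed
run-wise"; records `t4/T4-EST-NE4-P1.md`, `t4/T4-EST-NE4-P2.md`).  Every certified closure of node U2 so far
(`T4FlagMemory.injectedRate_of_scheme`, `T4FlagMemoryTwoRun.injectedRate_of_scheme_twoRun`, `T4TwoRunClosure` §§2–6,
`T4FlagMemoryAF.injectedRate_of_scheme_twoRun_af` / `injectedRate_of_scheme_twoRun_af_pinned` /
`injectedRate_of_split_scheme_eventual_af_pinned`) carries the memory gap `(1 + C′)ω < ρ` with ONE constant `C′` valid at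
every coupling of the box — for the coupling-weighted memory of [II] p. 8, `C′ = cγ`, the value at the LARGEST
coupling.  Along an actual run of (0.20) the memory constant of step `j` is `c·g_j`, and `g_j` is small on most of the
run.  THIS MODULE types the closure that uses this:
* (§1) the STEP-INDEXED RESOLVENT `renewal_stepState`: a renewal `x_j ≤ s_j + Σ_{m<j} M_{j,m}x_m` with
  `0 ≤ M_{j,m} ≤ C_j·ω^{j−m}` (domination by the constant OF THE STEP `j`) is dominated by the exact resolvent
  `s_j + C_j·Σ_{i<j} s_i ω^{j−i} ∏_{n∈]i,j[}(1 + C_n)` (`stepState_eq_sum`) — no monotonicity, no smallness; and its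
  geometric envelope `majorant_le_of_env`: if `∏_{n∈]i,j]}(1 + C_n) ≤ Λ·(1 + Cs)^{j−i}` along the run, the majorant is
  `Λ·Σ_{i≤j}((1 + Cs)ω)^{j−i}s_i`.  Dictionaries for the envelope: `env_le_prod_bad` (universal: Λ = the product of the
  step factors over ALL exceptional steps `C_n > Cs`, wherever they sit), `env_le_count` (at most `N` exceptional
  steps, all `≤ Cb`: `Λ = (1 + Cb)^N`), `prod_one_add_le_exp_sum` (`Λ ≤ exp Σ_{bad} C_n`).  CONTRAST
  `T4FlagMemoryAF.renewal_env`, whose domination `M_{j,m} ≤ D(m+1)·ω^{j−m}` is by the BIRTH index `m` and needs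
  `D(m+1) ≥ C_j` for every later step `j`: for step constants INCREASING along the run it forces `D ≡ sup_j C_j = cγ`
  and returns the box-uniform closure.
* (§2) the TWO-POINT FIXED POINT under the envelope, `twoPoint_fixedPoint_env` (+ count form
  `twoPoint_fixedPoint_afTail`): `T4TwoRunClosure.twoPoint_fixedPoint_summable` with the constant memory profile
  REPLACED by the step-dependent one; gap `(1 + Cs)ω < ρ < 1` against the envelope RATE only, window
  `q·Λ·U ≤ (1 − (1 + Cs)ω)/2`, conclusion `δ_j ≤ 2(p + qaκ)(1 − ρ)⁻¹ρ^j`, `κ = Λρ/(ρ − (1 + Cs)ω)`; constants free of K.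
* (§3) RUN LEVEL: the join asked RUN-WISE, `twoRunRenewal_of_scheme_runwise` (the two-run renewal only ever invokes
  the step-`j` memory AT RUN A's OWN COUPLING `g^A_j` — third leg of `T4FlagMemoryTwoRun.seqPairDist_renewal` — so a
  memory modulus along run A suffices), and `disc_le_of_twoRun_env` / `disc_le_of_twoRun_afTail` (the printed step
  `T4TwoRunMatching.disc_step_twoRun` + the fixed point, p = 0).
* (§4) ORIENTATION AND THE AF DICTIONARY along a run of (0.20) with `EventualLowerH b γ k₀ β`, `b > 0`:
  `lt_succ_of_eventualLower` — the couplings STRICTLY INCREASE toward the pin on the scales `k₀ ≤ i < K`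
  (`1/g_i² = 1/g_{i+1}² + β_{i+1} ≥ 1/g_{i+1}² + b`): the flag index runs FROM the ultraviolet end (step 0 = the
  finest lattice, [I] p. 256) TO the unit lattice; `sq_mul_le_one_of_eventualLower` — `b(K − i)g_i² ≤ 1`: the coupling
  at scale `i` is small in the NUMBER OF SCALES STILL TO GO, `K − i`, not in `i`; hence the steps with `c·g_j > ε` are
  among the first `k₀` and the LAST `⌈c²/(bε²)⌉` (`ir_block_of_exceptional`), their number is
  `≤ k₀ + ⌈c²/(bε²)⌉₊` (`card_filter_coupling_le`) and the product of their step factors is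
  `≤ (1 + cγ)^{k₀}·exp(2c√⌈c²/(bε²)⌉/√b)` (`prod_exceptional_coupling_le`, via `Σ_{m≤n} 1/√m ≤ 2√n`,
  `sum_Ico_inv_sqrt_le`) — BOTH K-UNIFORM, positions irrelevant to §2.
* (§5) SCHEME LEVEL from P1's `StepMemoryFn Φ γ (c·) ω` BY NAME: `injectedRate_of_fullScheme_twoRun_afTail` (count
  dictionary) and `injectedRate_of_fullScheme_twoRun_afTail_sum` (sum dictionary): node U2's output
  `T4CauchySum.InjectedRate (2·cr·a·Λ·ρ/(ρ − (1+ε)ω)·(1 − ρ)⁻¹) 0 ρ` on the coupling discrepancies of consecutive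
  pinned runs, for EVERY `ε > 0` with `(1 + ε)ω < ρ < 1`, under the window `cr·ℓ′·Λ·((k₀+1)γ³ + 2γ/b) ≤ (1 − (1+ε)ω)/2`
  with `Λ = (1 + cγ)^{k₀ + ⌈c²/(bε²)⌉}` resp. `(1 + cγ)^{k₀}·exp(2c√⌈c²/(bε²)⌉/√b)`.
* (§6, v1.1) the PRIMITIVE BOOKING of §5 in the currency of `T4TwoRunClosure` §3/§6: ONE number `ν < 1` with
  `θ ≤ ν` (source rate) and `(1 + ε)ω ≤ ν` (memory threshold — NO `γ`, NO `c`), rate `(1 + ν)/2`, window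
  `2·cr·ℓ′·Λ·((k₀+1)γ³ + 2γ/b) ≤ 1 − (1 + ε)ω`, constant `8·cr·a·Λ/(1 − ν)²`:
  `injectedRate_of_fullScheme_primitive_afTail` / `_sum` (arithmetic `rateConst_le_primitive_env`).

LOCATED OBJECTION (orientation; not against any kernel statement; raised FIRST by the referee seat t4-ref3-g5 as
cell GAPS G-t4r3-1 (journal l.49766) with a kernel witness, ACKNOWLEDGED by the owner lineage t4-ne4-p1 —
`T4FlagMemoryAF` v1.1 (p186434) relabels its §6 «non-increasing-run tail», withdraws the wording of G-ne4p1-4 quoted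
below and carries the witness as `T4FlagMemoryAF.lt_succ_of_rgEqH_lower` (§9); this lineage's answer row is GAPS
A-ne4p2g4-1, and `lt_succ_of_eventualLower` below is the SAME Prop as `T4FlagMemoryAF.lt_succ_of_rgEqH_lower` — two
names for one statement, both kept; downstream modules may cite either, this one is kept for name stability).  `T4FlagMemoryAF.sh_le_of_af_tail` / `dist_entry_le_of_af_tail` feed the AF tail through the
hypotheses `g (n+1) ≤ g n` (all n) and `c·g n ≤ ε` for `n ≥ n₀` along the flag index, and G-ne4p1-4 records "(0.20)
runs are non-increasing by (AF-0r)+tail_lower".  By `lt_succ_of_eventualLower` the runs of (0.20) under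
`EventualLowerH b γ k₀ β` with `b > 0` are STRICTLY INCREASING in the flag index from `k₀` on (the flag is born at the
ultraviolet end, [I] p. 256; the pin `g_K = gIR` is the largest coupling), so those hypotheses are met by no such run
past `k₀`, and "eventually small in n" is the reverse of the actual tail, which is small for `n ≤ K − n₀` — a condition
expressible only RELATIVE TO K.  The kernel theorems of `T4FlagMemoryAF` §6 are true as stated; what is unavailable
is their dictionary to (0.20).  The consumer typed here is position-free (§2 sees only the envelope constant), so it
serves the actual orientation; §4 is the dictionary.

HONEST LIMITS.  (i) Every scheme hypothesis is an UNPRINTED shape; `EventualLowerH` is the β sub-cell's undelivered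
input; the runs and the pin are binders.  (ii) The AF-tail form is NOT uniformly stronger than the box-uniform form
(`T4TwoRunClosure.injectedRate_of_fullScheme_twoRun_af` with `C′ = cγ`): it trades the gap constraint
`(1 + cγ)ω < ρ` for the envelope constant `Λ ≥ 1` inside the window; both windows are smallness conditions on `γ`
given `(c, b, k₀, ε, cr, ℓ′, ω, ρ)`; which is weaker depends on those numbers and is recorded, not adjudicated
(`t4/T4-EST-NE4-P2.md` §10).  The gain is structural: `c` (the memory constant per unit coupling, [II] (1.29)/(1.36),
unprinted as a number) no longer has to be small against the rate gap.  (iii) With `Cs = Cb` (no exceptional steps)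
§2/§3 return the box-uniform statements up to the harmless factor `ρ/(ρ − (1+C)ω)` vs `(ρ − ω)/(ρ − (1+C)ω)`.
(iv) Rung (B)+1 of the finite-T⁴ ladder only.

## What is typed and proved

(§1) `stepState` (+ `_zero`, `_succ`, `_eq_sum_gen`, `_eq_sum`, `_nonneg`), `renewal_stepState`,
`prod_one_add_le_count`, `majorant_le_of_env`, `env_le_count`, `env_le_prod_bad`, `prod_one_add_le_exp_sum`,
`majorant_le_count`.  (§2) `twoPoint_fixedPoint_env`, `twoPoint_fixedPoint_afTail`.  (§3)
`twoRunRenewal_of_scheme_runwise`, `disc_le_of_twoRun_env`, `disc_le_of_twoRun_afTail`.  (§4) `lt_succ_of_eventualLower`,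
`sq_mul_le_one_of_eventualLower`, `card_filter_coupling_le`, `sum_Ico_inv_sqrt_le`, `ir_block_of_exceptional`,
`prod_exceptional_coupling_le`.  (§5) `injectedRate_of_fullScheme_twoRun_afTail`, `injectedRate_of_fullScheme_twoRun_afTail_sum`.
(§6, v1.1) `rateConst_le_primitive_env`, `injectedRate_of_fullScheme_primitive_afTail`,
`injectedRate_of_fullScheme_primitive_afTail_sum`.

Deliberately NOT here: any instance of the one-step hypotheses for Bałaban's (2.13) (cell NE2/NE3/NE5/NE9 and the
memory constant — unprinted); the (AF-0r)/tail-lower input itself (β sub-cell); non-vacuity of `StepMemoryFn` with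
non-zero memory (it is `T4FlagMemoryAF` §7, `afStep`, imported lineage, restated nowhere); the comparison of the two
windows as numbers.  NEW module of unit `b2b-balaban-t4-ne4-p2` generation 4 (planner seat, NE4 technique P2
"two-trajectory comparison"; journal claim T4-U2.NE4-PROVE-P2d*, CLAIMS.log 2026-08-19); imports `T4TwoRunClosure`
(this lineage, v1.2) and `T4FlagMemoryAF` (lineage t4-ne4-p1, for `StepMemoryFn` only) and modifies nothing; Mathlib
otherwise; no `sorry`, no `axiom`.  Companion record `t4/T4-EST-NE4-P2.md` v1.4 §10.  v1.1 (same seat): `section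
Primitive` (§6, 3 decls) APPENDED after `end SchemeLevel`; every v1 declaration byte-identical; header amended only in
the §6 bullet, the orientation paragraph's attribution sentence and this list (record v1.5 §11).  v1.2 (lineage gen 5,
journal row T4-U2.NE4-PROVE-P2e*): DOCSTRING-ONLY fold of the cross-read certificate
`b2b-balaban-pv22-g14/XREAD-T4TwoRunAfTail-v1.md` (cell GAPS C-pv22g14-11; verdict ok (CONSISTENT), objections 0,
ABSOLUTE-RULE 0): D1 — the P1 closures are named by their tree declarations
`T4FlagMemoryAF.injectedRate_of_scheme_twoRun_af` / `…_pinned` / `injectedRate_of_split_scheme_eventual_af_pinned` (the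
v1/v1.1 text used a non-existent name); D2 — the orientation paragraph above and the docstring of
`lt_succ_of_eventualLower` name referee row G-t4r3-1, `T4FlagMemoryAF` v1.1 p186434 and the duplicate
`T4FlagMemoryAF.lt_succ_of_rgEqH_lower`; every declaration byte-identical to v1.1 (record v1.6 §12).
-/

namespace Literature.MathematicalPhysics.QuantumFieldTheory.Balaban1983to89.T4TwoRunAfTail

open Literature.MathematicalPhysics.QuantumFieldTheory.Balaban1983to89
open Literature.MathematicalPhysics.QuantumFieldTheory.Balaban1983to89.FlowStep
open Literature.MathematicalPhysics.QuantumFieldTheory.Balaban1983to89.T4CouplingMatching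
open Literature.MathematicalPhysics.QuantumFieldTheory.Balaban1983to89.T4TwoRunMatching
open Literature.MathematicalPhysics.QuantumFieldTheory.Balaban1983to89.T4FlagMemory
open Literature.MathematicalPhysics.QuantumFieldTheory.Balaban1983to89.T4FlagMemoryTwoRun
open Literature.MathematicalPhysics.QuantumFieldTheory.Balaban1983to89.T4TwoRunClosure
open Literature.MathematicalPhysics.QuantumFieldTheory.Balaban1983to89.T4BetaMemorySharp (acc acc_zero acc_succ)
open Finset

/-! ## §1 The step-indexed resolvent: discrete Grönwall for a memory kernel `M_{j,m} ≤ C_j ω^{j−m}` dominated by the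
constant OF THE STEP `j` (not of the birth index `m`) -/

section StepResolvent

/-- FORWARD STATE of the step-indexed majorant: `B₀ = 0`, `B_{j+1} = ω·((1 + C_j)·B_j + s_j)` — the ω-discounted sum
of the majorants `y_m = s_m + C_m B_m` of the entries born at the steps `m < j` (`stepState_eq_sum_gen`).
[folklore] -/
def stepState (C : ℕ → ℝ) (ω : ℝ) (s : ℕ → ℝ) : ℕ → ℝ
  | 0 => 0
  | j + 1 => ω * ((1 + C j) * stepState C ω s j + s j)

/-- No state before the first step. [folklore] -/
@[simp] theorem stepState_zero (C : ℕ → ℝ) (ω : ℝ) (s : ℕ → ℝ) : stepState C ω s 0 = 0 := rfl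

/-- One step of the state recursion. [folklore] -/
theorem stepState_succ (C : ℕ → ℝ) (ω : ℝ) (s : ℕ → ℝ) (j : ℕ) :
    stepState C ω s (j + 1) = ω * ((1 + C j) * stepState C ω s j + s j) := rfl

/-- UNROLLED FORM: `B_j = Σ_{m<j} ω^{j−m}·(s_m + C_m·B_m)` — the state is the discounted sum of the majorants.
[folklore] -/
theorem stepState_eq_sum_gen (C : ℕ → ℝ) (ω : ℝ) (s : ℕ → ℝ) :
    ∀ j, stepState C ω s j = ∑ m ∈ range j, ω ^ (j - m) * (s m + C m * stepState C ω s m) := by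
  intro j
  induction j with
  | zero => simp
  | succ j ih =>
    rw [Finset.sum_range_succ, show j + 1 - j = 1 by omega, pow_one]
    have h1 : ∑ m ∈ range j, ω ^ (j + 1 - m) * (s m + C m * stepState C ω s m)
        = ω * ∑ m ∈ range j, ω ^ (j - m) * (s m + C m * stepState C ω s m) := by
      rw [Finset.mul_sum]
      refine Finset.sum_congr rfl fun m hm => ?_
      have hm' := mem_range.mp hm
      rw [show j + 1 - m = (j - m) + 1 by omega, pow_succ]
      ring
    rw [h1, ← ih, stepState_succ]
    ring

/-- CLOSED FORM = THE EXACT RESOLVENT of the kernel `C_j ω^{j−m}`: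
`B_j = Σ_{i<j} s_i · ω^{j−i} · ∏_{n∈]i,j[} (1 + C_n)` (an influence born at `i` reaches the state before step `j`
amplified by every intermediate step's factor `1 + C_n`; the step-`j` factor `C_j` is applied by the majorant
`y_j = s_j + C_j B_j`). [folklore] -/
theorem stepState_eq_sum (C : ℕ → ℝ) (ω : ℝ) (s : ℕ → ℝ) :
    ∀ j, stepState C ω s j = ∑ i ∈ range j, s i * ω ^ (j - i) * ∏ n ∈ Ico (i + 1) j, (1 + C n) := by
  intro j
  induction j with
  | zero => simp
  | succ j ih =>
    rw [stepState_succ, ih, Finset.sum_range_succ]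
    have h2 : ∑ i ∈ range j, s i * ω ^ (j + 1 - i) * ∏ n ∈ Ico (i + 1) (j + 1), (1 + C n)
        = ω * ((1 + C j) * ∑ i ∈ range j, s i * ω ^ (j - i) * ∏ n ∈ Ico (i + 1) j, (1 + C n)) := by
      rw [Finset.mul_sum, Finset.mul_sum]
      refine Finset.sum_congr rfl fun i hi => ?_
      have hi' := mem_range.mp hi
      rw [Finset.prod_Ico_succ_top (by omega : i + 1 ≤ j), show j + 1 - i = (j - i) + 1 by omega, pow_succ]
      ring
    rw [h2, show j + 1 - j = 1 by omega, pow_one, Finset.Ico_self, Finset.prod_empty]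
    ring

/-- `B_j ≥ 0` for `C, ω, s ≥ 0`. [folklore] -/
theorem stepState_nonneg {C : ℕ → ℝ} {ω : ℝ} {s : ℕ → ℝ} (hC : ∀ n, 0 ≤ C n) (hω : 0 ≤ ω)
    (hs : ∀ n, 0 ≤ s n) : ∀ j, 0 ≤ stepState C ω s j := by
  intro j
  induction j with
  | zero => simp
  | succ j ih =>
    rw [stepState_succ]
    exact mul_nonneg hω (add_nonneg (mul_nonneg (by linarith [hC j]) ih) (hs j))

/-- **STEP-INDEXED DISCRETE GRÖNWALL (exact resolvent majorant).**  A renewal `x_j ≤ s_j + Σ_{m<j} M_{j,m} x_m` with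
non-negative sources whose memory kernel is dominated by the constant OF THE STEP, `0 ≤ M_{j,m} ≤ C_j·ω^{j−m}`, is
dominated by the majorant `x_j ≤ s_j + C_j·B_j`, `B = stepState C ω s` — i.e. by the exact resolvent
`s_j + C_j Σ_{i<j} s_i ω^{j−i} ∏_{n∈]i,j[}(1 + C_n)` (`stepState_eq_sum`).  NO monotonicity of `C` and no smallness
is needed.  (Contrast `T4FlagMemoryAF.renewal_env`, whose domination `M_{j,m} ≤ D(m+1)·ω^{j−m}` is by the BIRTH index
and needs `D(m+1) ≥ C_j` for all `j > m`: for step constants INCREASING along the run that forces `D ≡ sup C`.)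
Strong induction. [folklore] -/
theorem renewal_stepState {x s : ℕ → ℝ} {M : ℕ → ℕ → ℝ} {C : ℕ → ℝ} {ω : ℝ} (hω : 0 ≤ ω)
    (hC : ∀ n, 0 ≤ C n) (hs : ∀ j, 0 ≤ s j)
    (hM : ∀ j m, m < j → 0 ≤ M j m ∧ M j m ≤ C j * ω ^ (j - m))
    (hrec : ∀ j, x j ≤ s j + ∑ m ∈ range j, M j m * x m) :
    ∀ j, x j ≤ s j + C j * stepState C ω s j := by
  intro j
  induction j using Nat.strong_induction_on with
  | _ j ih =>
    have hy0 : ∀ m, 0 ≤ s m + C m * stepState C ω s m := fun m =>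
      add_nonneg (hs m) (mul_nonneg (hC m) (stepState_nonneg hC hω hs m))
    calc x j ≤ s j + ∑ m ∈ range j, M j m * x m := hrec j
      _ ≤ s j + ∑ m ∈ range j, C j * ω ^ (j - m) * (s m + C m * stepState C ω s m) := by
          refine add_le_add le_rfl (Finset.sum_le_sum fun m hm => ?_)
          have hmj := mem_range.mp hm
          calc M j m * x m ≤ M j m * (s m + C m * stepState C ω s m) :=
                mul_le_mul_of_nonneg_left (ih m hmj) (hM j m hmj).1
            _ ≤ C j * ω ^ (j - m) * (s m + C m * stepState C ω s m) :=
                mul_le_mul_of_nonneg_right (hM j m hmj).2 (hy0 m)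
      _ = s j + C j * stepState C ω s j := by
          rw [stepState_eq_sum_gen C ω s j, Finset.mul_sum]
          congr 1
          refine Finset.sum_congr rfl fun m _ => ?_
          ring

/-- COUNTING THE EXCEPTIONAL STEPS: if `0 ≤ C_n ≤ Cb` everywhere and `Cs ≥ 0`, then over any finite set of steps
`∏_{n∈S}(1 + C_n) ≤ (1 + Cb)^{#{n ∈ S : Cs < C_n}}·(1 + Cs)^{#S}` — only the NUMBER of steps whose constant exceeds
`Cs` enters, not their position. [folklore] -/
theorem prod_one_add_le_count {C : ℕ → ℝ} {Cs Cb : ℝ} (hC : ∀ n, 0 ≤ C n) (hCb : ∀ n, C n ≤ Cb)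
    (hCs : 0 ≤ Cs) (S : Finset ℕ) :
    ∏ n ∈ S, (1 + C n) ≤ (1 + Cb) ^ (S.filter (fun n => Cs < C n)).card * (1 + Cs) ^ S.card := by
  have hCb0 : 0 ≤ Cb := (hC 0).trans (hCb 0)
  rw [← Finset.prod_filter_mul_prod_filter_not S (fun n => Cs < C n)]
  refine mul_le_mul ?_ ?_ (Finset.prod_nonneg fun n _ => by linarith [hC n]) (pow_nonneg (by linarith) _)
  · calc ∏ n ∈ S.filter (fun n => Cs < C n), (1 + C n)
        ≤ ∏ n ∈ S.filter (fun n => Cs < C n), (1 + Cb) :=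
          Finset.prod_le_prod (fun n _ => by linarith [hC n]) fun n _ => by linarith [hCb n]
      _ = (1 + Cb) ^ (S.filter (fun n => Cs < C n)).card := Finset.prod_const _
  · calc ∏ n ∈ S.filter (fun n => ¬ Cs < C n), (1 + C n)
        ≤ ∏ n ∈ S.filter (fun n => ¬ Cs < C n), (1 + Cs) :=
          Finset.prod_le_prod (fun n _ => by linarith [hC n]) fun n hn => by
            have h := not_lt.mp (Finset.mem_filter.mp hn).2
            linarith
      _ = (1 + Cs) ^ (S.filter (fun n => ¬ Cs < C n)).card := Finset.prod_const _
      _ ≤ (1 + Cs) ^ S.card := pow_le_pow_right₀ (by linarith) (Finset.card_filter_le _ _)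

/-- THE MAJORANT UNDER A GEOMETRIC ENVELOPE OF THE STEP FACTORS: if `0 ≤ C_n`, `f ≥ 0`, and along the steps
`< K` the products of step factors are dominated by a geometric envelope at the rate `1 + Cs` up to a constant
`Λ ≥ 1`, `∏_{n∈]i,j]}(1 + C_n) ≤ Λ·(1 + Cs)^{j−i}` (`i ≤ j < K`), then for `n < K` the exact-resolvent majorant is
dominated by the GEOMETRIC one at the rate `(1 + Cs)ω` up to `Λ`:
`f_n + C_n·B_n ≤ Λ · Σ_{i≤n} ((1 + Cs)ω)^{n−i} f_i`.  (Two dictionaries for the envelope: the COUNT of exceptional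
steps, `env_le_count` below, and — not typed here — the SUM, `exp(Σ C_n)`.) [folklore] -/
theorem majorant_le_of_env {C f : ℕ → ℝ} {Cs Λ ω : ℝ} {K : ℕ} (hω : 0 ≤ ω) (hC : ∀ n, 0 ≤ C n)
    (hΛ : 1 ≤ Λ) (hf : ∀ n, 0 ≤ f n)
    (hEnv : ∀ i j, i ≤ j → j < K → ∏ n ∈ Ico (i + 1) (j + 1), (1 + C n) ≤ Λ * (1 + Cs) ^ (j - i))
    {n : ℕ} (hn : n < K) :
    f n + C n * stepState C ω f n
      ≤ Λ * ∑ i ∈ range (n + 1), ((1 + Cs) * ω) ^ (n - i) * f i := by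
  have hP0 : ∀ i, 0 ≤ ∏ m ∈ Ico (i + 1) n, (1 + C m) := fun i =>
    Finset.prod_nonneg fun m _ => by linarith [hC m]
  have hterm' : ∀ i ∈ range n, C n * (f i * ω ^ (n - i) * ∏ m ∈ Ico (i + 1) n, (1 + C m))
      ≤ Λ * (((1 + Cs) * ω) ^ (n - i) * f i) := by
    intro i hi
    have hi' := mem_range.mp hi
    have hQ : (1 + C n) * ∏ m ∈ Ico (i + 1) n, (1 + C m) = ∏ m ∈ Ico (i + 1) (n + 1), (1 + C m) := by
      rw [Finset.prod_Ico_succ_top (by omega : i + 1 ≤ n)]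
      ring
    have hQle : ∏ m ∈ Ico (i + 1) (n + 1), (1 + C m) ≤ Λ * (1 + Cs) ^ (n - i) := hEnv i n hi'.le hn
    calc C n * (f i * ω ^ (n - i) * ∏ m ∈ Ico (i + 1) n, (1 + C m))
        ≤ (1 + C n) * (f i * ω ^ (n - i) * ∏ m ∈ Ico (i + 1) n, (1 + C m)) :=
          mul_le_mul_of_nonneg_right (by linarith) (mul_nonneg (mul_nonneg (hf i) (pow_nonneg hω _)) (hP0 i))
      _ = f i * ω ^ (n - i) * ∏ m ∈ Ico (i + 1) (n + 1), (1 + C m) := by rw [← hQ]; ring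
      _ ≤ f i * ω ^ (n - i) * (Λ * (1 + Cs) ^ (n - i)) :=
          mul_le_mul_of_nonneg_left hQle (mul_nonneg (hf i) (pow_nonneg hω _))
      _ = Λ * (((1 + Cs) * ω) ^ (n - i) * f i) := by rw [mul_pow]; ring
  have h1 : C n * stepState C ω f n ≤ Λ * ∑ i ∈ range n, ((1 + Cs) * ω) ^ (n - i) * f i := by
    rw [stepState_eq_sum C ω f n, Finset.mul_sum, Finset.mul_sum]
    exact Finset.sum_le_sum hterm'
  have h4 : f n ≤ Λ * f n := le_mul_of_one_le_left (hf n) hΛ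
  rw [Finset.sum_range_succ, Nat.sub_self, pow_zero, one_mul, mul_add]
  linarith

/-- THE COUNT DICTIONARY for the envelope: if `0 ≤ C_n ≤ Cb` and at most `N` of the steps `n < K` have `C_n > Cs ≥ 0`,
then `∏_{n∈]i,j]}(1 + C_n) ≤ (1 + Cb)^N·(1 + Cs)^{j−i}` for `i ≤ j < K` — the POSITION of the exceptional steps is
irrelevant (`prod_one_add_le_count`). [folklore] -/
theorem env_le_count {C : ℕ → ℝ} {Cs Cb : ℝ} {K N : ℕ} (hC : ∀ n, 0 ≤ C n) (hCb : ∀ n, C n ≤ Cb)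
    (hCs : 0 ≤ Cs) (hN : ((range K).filter (fun n => Cs < C n)).card ≤ N) :
    ∀ i j, i ≤ j → j < K → ∏ n ∈ Ico (i + 1) (j + 1), (1 + C n) ≤ (1 + Cb) ^ N * (1 + Cs) ^ (j - i) := by
  intro i j hij hjK
  have hCb0 : 0 ≤ Cb := (hC 0).trans (hCb 0)
  have hcard : ((Ico (i + 1) (j + 1)).filter (fun m => Cs < C m)).card ≤ N :=
    (Finset.card_le_card (Finset.filter_subset_filter _ (fun m hm => by
      simp only [Finset.mem_Ico] at hm
      exact Finset.mem_range.mpr (by omega)))).trans hN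
  calc ∏ m ∈ Ico (i + 1) (j + 1), (1 + C m)
      ≤ (1 + Cb) ^ ((Ico (i + 1) (j + 1)).filter (fun m => Cs < C m)).card
          * (1 + Cs) ^ (Ico (i + 1) (j + 1)).card := prod_one_add_le_count hC hCb hCs _
    _ ≤ (1 + Cb) ^ N * (1 + Cs) ^ (j - i) := by
        rw [Nat.card_Ico, show j + 1 - (i + 1) = j - i by omega]
        exact mul_le_mul_of_nonneg_right (pow_le_pow_right₀ (by linarith) hcard) (pow_nonneg (by linarith) _)

/-- THE UNIVERSAL DICTIONARY for the envelope: with `Λ_bad = ∏_{n<K, C_n > Cs}(1 + C_n)` (the product of the step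
factors over ALL exceptional steps of the run, wherever they sit), `∏_{n∈]i,j]}(1 + C_n) ≤ Λ_bad·(1 + Cs)^{j−i}` for
`i ≤ j < K`.  Both the COUNT bound `Λ_bad ≤ (1 + Cb)^N` (`prod_one_add_le_count`) and the SUM bound
`Λ_bad ≤ exp(Σ_{bad} C_n)` (`prod_one_add_le_exp_sum`) factor through it. [folklore] -/
theorem env_le_prod_bad {C : ℕ → ℝ} {Cs : ℝ} {K : ℕ} (hC : ∀ n, 0 ≤ C n) (hCs : 0 ≤ Cs) :
    ∀ i j, i ≤ j → j < K → ∏ n ∈ Ico (i + 1) (j + 1), (1 + C n)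
      ≤ (∏ n ∈ (range K).filter (fun n => Cs < C n), (1 + C n)) * (1 + Cs) ^ (j - i) := by
  intro i j hij hjK
  rw [← Finset.prod_filter_mul_prod_filter_not (Ico (i + 1) (j + 1)) (fun n => Cs < C n)]
  refine mul_le_mul ?_ ?_ (Finset.prod_nonneg fun n _ => by linarith [hC n])
    (Finset.prod_nonneg fun n _ => by linarith [hC n])
  · have hsub : (Ico (i + 1) (j + 1)).filter (fun n => Cs < C n) ⊆ (range K).filter (fun n => Cs < C n) :=
      Finset.filter_subset_filter _ (fun m hm => by
        simp only [Finset.mem_Ico] at hm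
        exact Finset.mem_range.mpr (by omega))
    rw [← Finset.prod_sdiff hsub]
    refine le_mul_of_one_le_left (Finset.prod_nonneg fun n _ => by linarith [hC n]) ?_
    calc (1 : ℝ) = ∏ _n ∈ ((range K).filter (fun n => Cs < C n)) \ (Ico (i + 1) (j + 1)).filter (fun n => Cs < C n),
            (1 : ℝ) := Finset.prod_const_one.symm
      _ ≤ _ := Finset.prod_le_prod (fun _ _ => zero_le_one) (fun n _ => by linarith [hC n])
  · calc ∏ n ∈ (Ico (i + 1) (j + 1)).filter (fun n => ¬ Cs < C n), (1 + C n)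
        ≤ ∏ n ∈ (Ico (i + 1) (j + 1)).filter (fun n => ¬ Cs < C n), (1 + Cs) :=
          Finset.prod_le_prod (fun n _ => by linarith [hC n]) fun n hn => by
            have h := not_lt.mp (Finset.mem_filter.mp hn).2
            linarith
      _ = (1 + Cs) ^ ((Ico (i + 1) (j + 1)).filter (fun n => ¬ Cs < C n)).card := Finset.prod_const _
      _ ≤ (1 + Cs) ^ (j - i) := by
          refine pow_le_pow_right₀ (by linarith) ((Finset.card_filter_le _ _).trans ?_)
          rw [Nat.card_Ico]; omega

/-- THE SUM BOUND for a product of step factors: `∏_{n∈S}(1 + C_n) ≤ exp(Σ_{n∈S} C_n)` (`1 + x ≤ eˣ`).  Plugged into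
`env_le_prod_bad` it gives the envelope constant `exp(Σ_{bad} C_n)` — along a run of (0.20) the natural companion of
the count (§4: the exceptional couplings are square-summably small in the number of scales to go; the resulting
`Σ_{bad} c·g_j ≤ 2c·√(⌈c²/(bε²)⌉/b)`-type bound is NOT typed in this file). [folklore] -/
theorem prod_one_add_le_exp_sum {C : ℕ → ℝ} (S : Finset ℕ) (hC : ∀ n ∈ S, 0 ≤ C n) :
    ∏ n ∈ S, (1 + C n) ≤ Real.exp (∑ n ∈ S, C n) := by
  rw [Real.exp_sum]
  exact Finset.prod_le_prod (fun n hn => by linarith [hC n hn]) fun n _ => by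
    have h := Real.add_one_le_exp (C n)
    linarith

/-- THE MAJORANT UNDER A COUNT OF EXCEPTIONAL STEPS (`majorant_le_of_env` + `env_le_count`): at most `N` steps
`n < K` with `C_n > Cs`, all `C_n ≤ Cb`; then `f_n + C_n·B_n ≤ (1 + Cb)^N · Σ_{i≤n} ((1 + Cs)ω)^{n−i} f_i` for `n < K`.
[folklore] -/
theorem majorant_le_count {C f : ℕ → ℝ} {Cs Cb ω : ℝ} {K N : ℕ} (hω : 0 ≤ ω) (hC : ∀ n, 0 ≤ C n)
    (hCb : ∀ n, C n ≤ Cb) (hCs : 0 ≤ Cs) (hf : ∀ n, 0 ≤ f n)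
    (hN : ((range K).filter (fun n => Cs < C n)).card ≤ N) {n : ℕ} (hn : n < K) :
    f n + C n * stepState C ω f n
      ≤ (1 + Cb) ^ N * ∑ i ∈ range (n + 1), ((1 + Cs) * ω) ^ (n - i) * f i :=
  majorant_le_of_env hω hC (one_le_pow₀ (by linarith [(hC 0).trans (hCb 0)])) hf
    (env_le_count hC hCb hCs hN) hn

end StepResolvent

/-! ## §2 The two-point fixed point with STEP-DEPENDENT memory constants under a geometric envelope, and its AF-TAIL
form (at most `N` exceptional steps) -/

section AfTail

/-- **THE TWO-POINT FIXED POINT — STEP-DEPENDENT MEMORY UNDER A GEOMETRIC ENVELOPE.**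
As `T4TwoRunClosure.twoPoint_fixedPoint_summable` (`δ ≥ 0` pinned `δ_K = 0` with the backward step
`δ_j ≤ δ_{j+1} + pρ^j + q·s_j`; `s_j ≥ 0` with the forward renewal `s_j ≤ aρ^j + e_j·δ_j + Σ_{i<j} M_{j,i}s_i`;
summable weights `0 ≤ e_j`, `Σ_{j<K} e_j ≤ U`), but with the CONSTANT memory profile `M_{j,i} ≤ Cω^{j−i}` REPLACED by a
STEP-DEPENDENT one, `0 ≤ M_{j,i} ≤ C_j·ω^{j−i}`, `C_j ≥ 0`, whose step factors have a geometric envelope along the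
steps `< K`: `∏_{n∈]i,j]}(1 + C_n) ≤ Λ·(1 + Cs)^{j−i}` for `i ≤ j < K`, some `Λ ≥ 1`, `Cs ≥ 0`.  Then the gap is
against the envelope rate only, `(1 + Cs)ω < ρ < 1`, the window is `q·Λ·U ≤ (1 − (1 + Cs)ω)/2`, and with
`κ = Λ·ρ/(ρ − (1 + Cs)ω)`: `δ_j ≤ 2(p + qaκ)(1 − ρ)⁻¹ρ^j` (`j ≤ K`) and `s_j ≤ (aκ + ΛU·2(p + qaκ)(1 − ρ)⁻¹)ρ^j`
(`j < K`).  Constants free of `K`.  Proof: §1's step-indexed resolvent (`renewal_stepState`) and the envelope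
(`majorant_le_of_env`) turn the loop forcing into `Λ·acc ((1+Cs)ω) (e·δ) (j+1)`; then the backward summation by parts
`T4TwoRunClosure.acc_Ico_sum_le` and the absorption against `1 − (1 + Cs)ω` exactly as in §6 of `T4TwoRunClosure`.
[folklore] -/
theorem twoPoint_fixedPoint_env {K : ℕ} {δ s e C : ℕ → ℝ} {M : ℕ → ℕ → ℝ} {a p q U Cs Λ ω ρ : ℝ}
    (hρ1 : ρ < 1) (hω : 0 ≤ ω) (hCs : 0 ≤ Cs) (hsmall : (1 + Cs) * ω < ρ)
    (ha : 0 ≤ a) (hp : 0 ≤ p) (hq : 0 ≤ q)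
    (hδ : ∀ j, 0 ≤ δ j) (hs : ∀ j, j < K → 0 ≤ s j) (he : ∀ j, j < K → 0 ≤ e j)
    (hU : ∑ j ∈ range K, e j ≤ U)
    (hC : ∀ j, 0 ≤ C j) (hΛ1 : 1 ≤ Λ)
    (hEnv : ∀ i j, i ≤ j → j < K → ∏ n ∈ Ico (i + 1) (j + 1), (1 + C n) ≤ Λ * (1 + Cs) ^ (j - i))
    (hM : ∀ j i, i < j → 0 ≤ M j i ∧ M j i ≤ C j * ω ^ (j - i))
    (hK : δ K = 0)
    (hback : ∀ j, j < K → δ j ≤ δ (j + 1) + p * ρ ^ j + q * s j)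
    (hfwd : ∀ j, j < K → s j ≤ a * ρ ^ j + e j * δ j + ∑ i ∈ range j, M j i * s i)
    (hwin : q * Λ * U ≤ (1 - (1 + Cs) * ω) / 2) :
    (∀ j, j ≤ K → δ j ≤ 2 * (p + q * a * (Λ * (ρ / (ρ - (1 + Cs) * ω)))) / (1 - ρ) * ρ ^ j) ∧
    (∀ j, j < K → s j ≤ (a * (Λ * (ρ / (ρ - (1 + Cs) * ω)))
        + Λ * U * (2 * (p + q * a * (Λ * (ρ / (ρ - (1 + Cs) * ω)))) / (1 - ρ))) * ρ ^ j) := by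
  set κ := Λ * (ρ / (ρ - (1 + Cs) * ω)) with hκ
  have hΛ0 : (0 : ℝ) ≤ Λ := zero_le_one.trans hΛ1
  have ht0 : 0 ≤ (1 + Cs) * ω := by positivity
  have hρ0 : 0 < ρ := lt_of_le_of_lt ht0 hsmall
  have ht1 : (1 + Cs) * ω < 1 := hsmall.trans hρ1
  have h1t : 0 < 1 - (1 + Cs) * ω := sub_pos.mpr ht1
  have hden : 0 < ρ - (1 + Cs) * ω := sub_pos.mpr hsmall
  have hκ0 : 0 ≤ κ := mul_nonneg hΛ0 (div_nonneg hρ0.le hden.le)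
  have h1ρ : 0 < 1 - ρ := sub_pos.mpr hρ1
  have hU0 : 0 ≤ U := (Finset.sum_nonneg fun j hj => he j (mem_range.mp hj)).trans hU
  -- the weighted maximum of δ over j ≤ K
  have hne : (range (K + 1)).Nonempty := ⟨0, by simp⟩
  set D := (range (K + 1)).sup' hne (fun i => δ i / ρ ^ i) with hD
  have hDi : ∀ i, i ≤ K → δ i ≤ D * ρ ^ i := by
    intro i hi
    have h : δ i / ρ ^ i ≤ D :=
      Finset.le_sup' (fun i => δ i / ρ ^ i) (Finset.mem_range.mpr (Nat.lt_succ_of_le hi))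
    rwa [div_le_iff₀ (pow_pos hρ0 i)] at h
  have hD0 : 0 ≤ D := by
    have h : δ 0 / ρ ^ 0 ≤ D :=
      Finset.le_sup' (fun i => δ i / ρ ^ i) (Finset.mem_range.mpr (Nat.succ_pos K))
    have : (0 : ℝ) ≤ δ 0 / ρ ^ 0 := by simpa using hδ 0
    exact this.trans h
  -- the loop forcing W_m = e_m δ_m (truncated at K) and its bounds
  set W : ℕ → ℝ := fun m => if m < K then e m * δ m else 0 with hW
  have hWK : ∀ m, m < K → W m = e m * δ m := fun m hm => by simp [hW, hm]
  have hW0 : ∀ m, 0 ≤ W m := by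
    intro m
    by_cases hm : m < K
    · rw [hWK m hm]; exact mul_nonneg (he m hm) (hδ m)
    · simp [hW, hm]
  have hWle : ∀ m, m < K → W m ≤ e m * (D * ρ ^ m) := fun m hm => by
    rw [hWK m hm]; exact mul_le_mul_of_nonneg_left (hDi m hm.le) (he m hm)
  have hWρ : ∀ n m, m < K → m ≤ n → ((1 + Cs) * ω) ^ (n - m) * W m ≤ D * ρ ^ n * e m := by
    intro n m hmK hmn
    have h1 : ((1 + Cs) * ω) ^ (n - m) ≤ ρ ^ (n - m) := pow_le_pow_left₀ ht0 hsmall.le _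
    calc ((1 + Cs) * ω) ^ (n - m) * W m ≤ ρ ^ (n - m) * (e m * (D * ρ ^ m)) :=
          mul_le_mul h1 (hWle m hmK) (hW0 m) (pow_nonneg hρ0.le _)
      _ = D * (ρ ^ (n - m) * ρ ^ m) * e m := by ring
      _ = D * ρ ^ n * e m := by rw [← pow_add, Nat.sub_add_cancel hmn]
  have htacc : ∀ n, (1 + Cs) * ω * acc ((1 + Cs) * ω) W n
      = ∑ m ∈ range n, ((1 + Cs) * ω) ^ (n - m) * W m := by
    intro n
    rw [acc, Finset.mul_sum]
    refine Finset.sum_congr rfl fun m hm => ?_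
    have hm' := mem_range.mp hm
    rw [show n - m = (n - 1 - m) + 1 by omega, pow_succ]
    ring
  have hacc1 : ∀ n, acc ((1 + Cs) * ω) W (n + 1) = ∑ m ∈ range (n + 1), ((1 + Cs) * ω) ^ (n - m) * W m := by
    intro n
    rw [acc]
    refine Finset.sum_congr rfl fun m _ => ?_
    rw [Nat.add_sub_cancel]
  have hsumW : ∀ n, n ≤ K →
      ∑ m ∈ range n, ((1 + Cs) * ω) ^ (n - m) * W m ≤ D * ρ ^ n * ∑ m ∈ range n, e m := by
    intro n hn
    rw [Finset.mul_sum]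
    exact Finset.sum_le_sum fun m hm =>
      hWρ n m (lt_of_lt_of_le (mem_range.mp hm) hn) (mem_range.mp hm).le
  have hIcoW : ∀ j, j ≤ K → ∑ i ∈ Ico j K, W i ≤ D * ρ ^ j * ∑ i ∈ Ico j K, e i := by
    intro j hj
    rw [Finset.mul_sum]
    refine Finset.sum_le_sum fun i hi => ?_
    obtain ⟨hji, hiK⟩ := Finset.mem_Ico.mp hi
    have h1 : ρ ^ i ≤ ρ ^ j := pow_le_pow_of_le_one hρ0.le hρ1.le hji
    calc W i ≤ e i * (D * ρ ^ i) := hWle i hiK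
      _ ≤ e i * (D * ρ ^ j) := mul_le_mul_of_nonneg_left (mul_le_mul_of_nonneg_left h1 hD0) (he i hiK)
      _ = D * ρ ^ j * e i := by ring
  have hsplitU : ∀ j, j ≤ K → ∑ m ∈ range j, e m + ∑ i ∈ Ico j K, e i = ∑ m ∈ range K, e m := by
    intro j hj
    rw [Finset.range_eq_Ico, Finset.range_eq_Ico]
    exact Finset.sum_Ico_consecutive e (Nat.zero_le j) hj
  -- Step 1: the step-indexed resolvent (§1) applied to the truncated bracket discrepancies, then the count
  set s' : ℕ → ℝ := fun j => if j < K then s j else 0 with hs'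
  have hs'K : ∀ j, j < K → s' j = s j := fun j hj => by simp [hs', hj]
  have hs'0 : ∀ j, 0 ≤ s' j := by
    intro j
    by_cases hj : j < K
    · rw [hs'K j hj]; exact hs j hj
    · simp [hs', hj]
  set f : ℕ → ℝ := fun m => a * ρ ^ m + W m with hf
  have hf0 : ∀ m, 0 ≤ f m := fun m => add_nonneg (mul_nonneg ha (pow_nonneg hρ0.le m)) (hW0 m)
  have hren : ∀ n, s' n ≤ f n + ∑ m ∈ range n, M n m * s' m := by
    intro n
    have hmem0 : 0 ≤ ∑ m ∈ range n, M n m * s' m :=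
      Finset.sum_nonneg fun m hm => mul_nonneg (hM n m (mem_range.mp hm)).1 (hs'0 m)
    by_cases hn : n < K
    · rw [hs'K n hn]
      have h1 := hfwd n hn
      have h2 : ∑ i ∈ range n, M n i * s i = ∑ m ∈ range n, M n m * s' m :=
        Finset.sum_congr rfl fun m hm => by rw [hs'K m ((mem_range.mp hm).trans hn)]
      have h3 : e n * δ n = W n := (hWK n hn).symm
      show s n ≤ (a * ρ ^ n + W n) + ∑ m ∈ range n, M n m * s' m
      linarith [h2, h3]
    · have h4 : s' n = 0 := by simp [hs', hn]
      rw [h4]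
      linarith [hf0 n]
  have hres := renewal_stepState hω hC hf0 hM hren
  have hsplit : ∀ n, ∑ i ∈ range (n + 1), ((1 + Cs) * ω) ^ (n - i) * f i
      = a * acc ((1 + Cs) * ω) (fun m => ρ ^ m) (n + 1) + acc ((1 + Cs) * ω) W (n + 1) := by
    intro n
    rw [acc, acc, Finset.mul_sum, ← Finset.sum_add_distrib]
    refine Finset.sum_congr rfl fun i _ => ?_
    simp only [hf, Nat.add_sub_cancel]
    ring
  have hsrc : ∀ n, a * acc ((1 + Cs) * ω) (fun m => ρ ^ m) (n + 1) ≤ a * (ρ / (ρ - (1 + Cs) * ω)) * ρ ^ n := by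
    intro n
    have h1 := acc_geom_le ht0 hsmall (n + 1)
    have e1 : ρ ^ (n + 1) / (ρ - (1 + Cs) * ω) = ρ / (ρ - (1 + Cs) * ω) * ρ ^ n := by
      rw [pow_succ]; ring
    rw [e1] at h1
    have := mul_le_mul_of_nonneg_left h1 ha
    linarith
  have hsn : ∀ n, n < K → s n ≤ a * κ * ρ ^ n + Λ * acc ((1 + Cs) * ω) W (n + 1) := by
    intro n hn
    have h1 := hres n
    rw [hs'K n hn] at h1
    have h2 := majorant_le_of_env hω hC hΛ1 hf0 hEnv hn
    rw [hsplit n] at h2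
    have h3 : Λ * (a * acc ((1 + Cs) * ω) (fun m => ρ ^ m) (n + 1))
        ≤ Λ * (a * (ρ / (ρ - (1 + Cs) * ω)) * ρ ^ n) := mul_le_mul_of_nonneg_left (hsrc n) hΛ0
    have e2 : Λ * (a * (ρ / (ρ - (1 + Cs) * ω)) * ρ ^ n) = a * κ * ρ ^ n := by rw [hκ]; ring
    have e3 : Λ * (a * acc ((1 + Cs) * ω) (fun m => ρ ^ m) (n + 1) + acc ((1 + Cs) * ω) W (n + 1))
        = Λ * (a * acc ((1 + Cs) * ω) (fun m => ρ ^ m) (n + 1)) + Λ * acc ((1 + Cs) * ω) W (n + 1) := by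
      ring
    linarith [e2, e3]
  -- Step 2: backward accumulation from the pin
  have hc0 : 0 ≤ p + q * (a * κ) := by positivity
  have hqΛ : 0 ≤ q * Λ := mul_nonneg hq hΛ0
  have hback' : ∀ j, j < K →
      δ j ≤ δ (j + 1) + ((p + q * (a * κ)) * ρ ^ j + q * Λ * acc ((1 + Cs) * ω) W (j + 1)) := by
    intro j hj
    have h1 := hback j hj
    have h2 : q * s j ≤ q * (a * κ * ρ ^ j + Λ * acc ((1 + Cs) * ω) W (j + 1)) :=
      mul_le_mul_of_nonneg_left (hsn j hj) hq
    have e3 : q * (a * κ * ρ ^ j + Λ * acc ((1 + Cs) * ω) W (j + 1))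
        = q * (a * κ) * ρ ^ j + q * Λ * acc ((1 + Cs) * ω) W (j + 1) := by ring
    have e4 : δ (j + 1) + ((p + q * (a * κ)) * ρ ^ j + q * Λ * acc ((1 + Cs) * ω) W (j + 1))
        = δ (j + 1) + p * ρ ^ j + (q * (a * κ) * ρ ^ j + q * Λ * acc ((1 + Cs) * ω) W (j + 1)) := by ring
    linarith [e3, e4]
  have hδsum := backward_sum (le_of_eq hK) hback'
  have hδb : ∀ j, j ≤ K →
      δ j ≤ ((p + q * (a * κ)) / (1 - ρ) + q * Λ * U * D / (1 - (1 + Cs) * ω)) * ρ ^ j := by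
    intro j hj
    have h1 := hδsum j hj
    rw [Finset.sum_add_distrib, ← Finset.mul_sum, ← Finset.mul_sum] at h1
    have hgeo : ∑ i ∈ Ico j K, ρ ^ i ≤ ρ ^ j / (1 - ρ) := geom_sum_Ico_le_of_lt_one hρ0.le hρ1
    have hS := acc_Ico_sum_le ht0 hW0 hj
    have hA : (1 + Cs) * ω * acc ((1 + Cs) * ω) W j ≤ D * ρ ^ j * ∑ m ∈ range j, e m := by
      rw [htacc]; exact hsumW j hj
    have hB := hIcoW j hj
    have hsumU : D * ρ ^ j * ∑ m ∈ range j, e m + D * ρ ^ j * ∑ i ∈ Ico j K, e i ≤ D * ρ ^ j * U := by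
      rw [← mul_add, hsplitU j hj]
      exact mul_le_mul_of_nonneg_left hU (mul_nonneg hD0 (pow_nonneg hρ0.le j))
    have hS1 : (1 - (1 + Cs) * ω) * ∑ i ∈ Ico j K, acc ((1 + Cs) * ω) W (i + 1) ≤ D * ρ ^ j * U := by
      linarith [hS, hA, hB, hsumU]
    have hS' : ∑ i ∈ Ico j K, acc ((1 + Cs) * ω) W (i + 1) ≤ D * ρ ^ j * U / (1 - (1 + Cs) * ω) := by
      rw [le_div_iff₀' h1t]
      exact hS1
    calc δ j ≤ (p + q * (a * κ)) * ∑ i ∈ Ico j K, ρ ^ i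
          + q * Λ * ∑ i ∈ Ico j K, acc ((1 + Cs) * ω) W (i + 1) := h1
      _ ≤ (p + q * (a * κ)) * (ρ ^ j / (1 - ρ)) + q * Λ * (D * ρ ^ j * U / (1 - (1 + Cs) * ω)) :=
          add_le_add (mul_le_mul_of_nonneg_left hgeo hc0) (mul_le_mul_of_nonneg_left hS' hqΛ)
      _ = ((p + q * (a * κ)) / (1 - ρ) + q * Λ * U * D / (1 - (1 + Cs) * ω)) * ρ ^ j := by ring
  -- Step 3: absorption at the maximiser, against the GOOD memory gap `1 − (1 + Cs)ω`
  obtain ⟨i₀, hi₀, hDi₀⟩ := Finset.exists_mem_eq_sup' hne (fun i => δ i / ρ ^ i)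
  have hi₀K : i₀ ≤ K := Nat.lt_succ_iff.mp (Finset.mem_range.mp hi₀)
  have hDle : D ≤ (p + q * (a * κ)) / (1 - ρ) + q * Λ * U * D / (1 - (1 + Cs) * ω) := by
    calc D = δ i₀ / ρ ^ i₀ := hDi₀
      _ ≤ (p + q * (a * κ)) / (1 - ρ) + q * Λ * U * D / (1 - (1 + Cs) * ω) := by
          rw [div_le_iff₀ (pow_pos hρ0 i₀)]
          exact hδb i₀ hi₀K
  have hhalf : q * Λ * U * D / (1 - (1 + Cs) * ω) ≤ D / 2 := by
    rw [div_le_iff₀ h1t]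
    have h := mul_le_mul_of_nonneg_right hwin hD0
    have e5 : (1 - (1 + Cs) * ω) / 2 * D = D / 2 * (1 - (1 + Cs) * ω) := by ring
    linarith [e5]
  have hD2 : D ≤ 2 * ((p + q * (a * κ)) / (1 - ρ)) := by linarith [hDle, hhalf]
  -- Step 4: read off both bounds
  refine ⟨fun j hj => ?_, fun j hj => ?_⟩
  · calc δ j ≤ D * ρ ^ j := hDi j hj
      _ ≤ 2 * ((p + q * (a * κ)) / (1 - ρ)) * ρ ^ j := mul_le_mul_of_nonneg_right hD2 (pow_nonneg hρ0.le j)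
      _ = 2 * (p + q * a * κ) / (1 - ρ) * ρ ^ j := by ring
  · have h1 := hsn j hj
    have h2 : acc ((1 + Cs) * ω) W (j + 1) ≤ D * ρ ^ j * ∑ m ∈ range (j + 1), e m := by
      rw [hacc1, Finset.mul_sum]
      exact Finset.sum_le_sum fun m hm =>
        hWρ j m (lt_of_le_of_lt (Nat.lt_succ_iff.mp (mem_range.mp hm)) hj) (Nat.lt_succ_iff.mp (mem_range.mp hm))
    have h3 : ∑ m ∈ range (j + 1), e m ≤ U :=
      (Finset.sum_le_sum_of_subset_of_nonneg (Finset.range_mono (Nat.succ_le_of_lt hj))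
        (fun i hi _ => he i (mem_range.mp hi))).trans hU
    have h4 : D * ρ ^ j * ∑ m ∈ range (j + 1), e m ≤ D * ρ ^ j * U :=
      mul_le_mul_of_nonneg_left h3 (mul_nonneg hD0 (pow_nonneg hρ0.le j))
    have h5 : D * ρ ^ j * U ≤ 2 * ((p + q * (a * κ)) / (1 - ρ)) * ρ ^ j * U :=
      mul_le_mul_of_nonneg_right (mul_le_mul_of_nonneg_right hD2 (pow_nonneg hρ0.le j)) hU0
    have h6 : Λ * acc ((1 + Cs) * ω) W (j + 1) ≤ Λ * (2 * ((p + q * (a * κ)) / (1 - ρ)) * ρ ^ j * U) :=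
      mul_le_mul_of_nonneg_left (by linarith) hΛ0
    calc s j ≤ a * κ * ρ ^ j + Λ * acc ((1 + Cs) * ω) W (j + 1) := h1
      _ ≤ a * κ * ρ ^ j + Λ * (2 * ((p + q * (a * κ)) / (1 - ρ)) * ρ ^ j * U) := by linarith
      _ = (a * κ + Λ * U * (2 * (p + q * a * κ) / (1 - ρ))) * ρ ^ j := by ring


/-- **THE TWO-POINT FIXED POINT — AF-TAIL FORM (memory constants of the steps, at most `N` of them above `Cs`).**
`twoPoint_fixedPoint_env` with the COUNT dictionary `env_le_count`: `0 ≤ C_j ≤ Cb` at every step and `C_j ≤ Cs` at all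
but at most `N` of the steps `j < K` (their POSITION is irrelevant); `Λ = (1 + Cb)^N`; gap `(1 + Cs)ω < ρ < 1`, window
`q·(1 + Cb)^N·U ≤ (1 − (1 + Cs)ω)/2`. [folklore] -/
theorem twoPoint_fixedPoint_afTail {K N : ℕ} {δ s e C : ℕ → ℝ} {M : ℕ → ℕ → ℝ} {a p q U Cs Cb ω ρ : ℝ}
    (hρ1 : ρ < 1) (hω : 0 ≤ ω) (hCs : 0 ≤ Cs) (hsmall : (1 + Cs) * ω < ρ)
    (ha : 0 ≤ a) (hp : 0 ≤ p) (hq : 0 ≤ q)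
    (hδ : ∀ j, 0 ≤ δ j) (hs : ∀ j, j < K → 0 ≤ s j) (he : ∀ j, j < K → 0 ≤ e j)
    (hU : ∑ j ∈ range K, e j ≤ U)
    (hC : ∀ j, 0 ≤ C j) (hCb : ∀ j, C j ≤ Cb) (hN : ((range K).filter (fun j => Cs < C j)).card ≤ N)
    (hM : ∀ j i, i < j → 0 ≤ M j i ∧ M j i ≤ C j * ω ^ (j - i))
    (hK : δ K = 0)
    (hback : ∀ j, j < K → δ j ≤ δ (j + 1) + p * ρ ^ j + q * s j)
    (hfwd : ∀ j, j < K → s j ≤ a * ρ ^ j + e j * δ j + ∑ i ∈ range j, M j i * s i)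
    (hwin : q * (1 + Cb) ^ N * U ≤ (1 - (1 + Cs) * ω) / 2) :
    (∀ j, j ≤ K → δ j ≤ 2 * (p + q * a * ((1 + Cb) ^ N * (ρ / (ρ - (1 + Cs) * ω)))) / (1 - ρ) * ρ ^ j) ∧
    (∀ j, j < K → s j ≤ (a * ((1 + Cb) ^ N * (ρ / (ρ - (1 + Cs) * ω)))
        + (1 + Cb) ^ N * U * (2 * (p + q * a * ((1 + Cb) ^ N * (ρ / (ρ - (1 + Cs) * ω)))) / (1 - ρ)))
          * ρ ^ j) :=
  twoPoint_fixedPoint_env hρ1 hω hCs hsmall ha hp hq hδ hs he hU hC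
    (one_le_pow₀ (by linarith [(hC 0).trans (hCb 0)])) (env_le_count hC hCb hCs hN) hM hK hback hfwd hwin

end AfTail

/-! ## §3 Run level: two pinned runs of (0.20), the full mismatch read out, STEP-WEIGHTED memory along run A -/

section RunLevel

variable {X : Type*} [PseudoMetricSpace X] [Inhabited X]

/-- **JOIN UNDER A RUN-WISE MEMORY MODULUS.**  `T4FlagMemoryTwoRun.twoRunRenewal_of_scheme` asks the memory shape
`StepMemory Φ M′` at EVERY coupling; the two-run renewal only ever invokes the step-`j` map's memory AT RUN A's OWN
COUPLING `g^A_j` (the third leg of `T4FlagMemoryTwoRun.seqPairDist_renewal`).  So a memory modulus asked along run A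
only — `dist (Φ j g^A_j y) (Φ j g^A_j y′) ≤ Σ_{m<j} C_j ω^{j−m} dist (y m) (y′ m)` for `j < K`, with a STEP constant `C_j`
(e.g. `C_j = c·g^A_j`, the coupling-weighted memory `T4FlagMemoryAF.StepMemoryFn Φ γ (c·) ω` read along the run) —
together with `StepDirect Φ ℓ′ γ`, `StepShift Φ γ src`, `src k ≤ aρ^k` and two runs in the box gives
`TwoRunRenewal a ℓ′ ρ (C_j ω^{j−m}) gA gB (pairDist Φ gA gB K) K`.  HYPOTHESES ONLY about the scheme; nothing of
[Balaban1987RG1] is asserted. [cite: Balaban1987RG1, (2.12)-(2.13) p.268] -/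
theorem twoRunRenewal_of_scheme_runwise {Φ : ℕ → ℝ → (ℕ → X) → X} {src C : ℕ → ℝ} {ℓ' γ a ρ ω : ℝ}
    {K : ℕ} {gA gB : ℕ → ℝ} (hdir : StepDirect Φ ℓ' γ)
    (hmemA : ∀ j (y y' : ℕ → X), j < K →
      dist (Φ j (gA j) y) (Φ j (gA j) y') ≤ ∑ m ∈ range j, C j * ω ^ (j - m) * dist (y m) (y' m))
    (hsh : StepShift Φ γ src) (hsrc : ∀ k, src k ≤ a * ρ ^ k)
    (hAbox : ∀ i, i ≤ K → 0 < gA i ∧ gA i ≤ γ) (hBbox : ∀ i, i ≤ K + 1 → 0 < gB i ∧ gB i ≤ γ) :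
    TwoRunRenewal a ℓ' ρ (fun j m => C j * ω ^ (j - m)) gA gB (pairDist Φ gA gB K) K := by
  intro j hj
  have hB : Adm γ (extd (prefixOf gB (K + 1))) := extd_adm (prefixOf_mem_box le_rfl hBbox)
  have hAj : extd (prefixOf gA K) j = gA j := extd_prefixOf hj.le
  have hBj : extd (prefixOf gB (K + 1)) (j + 1) = gB (j + 1) := extd_prefixOf (show j + 1 ≤ K + 1 by omega)
  -- the three legs of `seqPairDist_renewal`, the memory asked at run A's coupling `gA j` only
  have h1 : dist (entry Φ (extd (prefixOf gB (K + 1))) (j + 1))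
      (Φ j (extd (prefixOf gB (K + 1)) (j + 1))
        (fun m => if m < j then entry Φ (extd (prefixOf gB (K + 1))) (m + 1) else default)) ≤ src j :=
    hsh _ hB j
  have h2 : dist (Φ j (extd (prefixOf gB (K + 1)) (j + 1))
        (fun m => if m < j then entry Φ (extd (prefixOf gB (K + 1))) (m + 1) else default))
      (Φ j (gA j) (fun m => if m < j then entry Φ (extd (prefixOf gB (K + 1))) (m + 1) else default))
      ≤ ℓ' * |gA j - gB (j + 1)| := by
    rw [abs_sub_comm, hBj]
    exact hdir j _ _ _ (hBbox (j + 1) (by omega)).1 (hBbox (j + 1) (by omega)).2 (hAbox j hj.le).1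
      (hAbox j hj.le).2
  have h3 : dist (Φ j (gA j) (fun m => if m < j then entry Φ (extd (prefixOf gB (K + 1))) (m + 1) else default))
      (entry Φ (extd (prefixOf gA K)) j) ≤ ∑ m ∈ range j, C j * ω ^ (j - m) * pairDist Φ gA gB K m := by
    rw [entry_def Φ (extd (prefixOf gA K)) j, hAj]
    refine (hmemA j _ (flag Φ (extd (prefixOf gA K)) j) hj).trans (le_of_eq ?_)
    refine Finset.sum_congr rfl fun m hm => ?_
    have hmj : m < j := mem_range.mp hm
    simp only [if_pos hmj, flag_apply, pairDist, seqPairDist]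
  have hs := hsrc j
  show pairDist Φ gA gB K j
    ≤ a * ρ ^ j + ℓ' * |gA j - gB (j + 1)| + ∑ i ∈ range j, C j * ω ^ (j - i) * pairDist Φ gA gB K i
  calc pairDist Φ gA gB K j
      ≤ dist (entry Φ (extd (prefixOf gB (K + 1))) (j + 1))
            (Φ j (extd (prefixOf gB (K + 1)) (j + 1))
              (fun m => if m < j then entry Φ (extd (prefixOf gB (K + 1))) (m + 1) else default))
        + dist (Φ j (extd (prefixOf gB (K + 1)) (j + 1))
              (fun m => if m < j then entry Φ (extd (prefixOf gB (K + 1))) (m + 1) else default))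
            (Φ j (gA j) (fun m => if m < j then entry Φ (extd (prefixOf gB (K + 1))) (m + 1) else default))
        + dist (Φ j (gA j) (fun m => if m < j then entry Φ (extd (prefixOf gB (K + 1))) (m + 1) else default))
            (entry Φ (extd (prefixOf gA K)) j) :=
        dist_triangle4 _ _ _ _
    _ ≤ src j + ℓ' * |gA j - gB (j + 1)| + ∑ m ∈ range j, C j * ω ^ (j - m) * pairDist Φ gA gB K m :=
        add_le_add (add_le_add h1 h2) h3
    _ ≤ a * ρ ^ j + ℓ' * |gA j - gB (j + 1)| + ∑ i ∈ range j, C j * ω ^ (j - i) * pairDist Φ gA gB K i := by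
        linarith

/-- **THE TWO-POINT SYSTEM WITH THE FULL MISMATCH READ OUT — STEP-WEIGHTED MEMORY UNDER AN ENVELOPE**
(`T4TwoRunClosure.disc_le_of_twoRun_af` with its memory hypothesis `FadingMemory C ω M` REPLACED by a STEP-WEIGHTED
kernel bound `0 ≤ M_{j,i} ≤ C_j ω^{j−i}`, `C_j ≥ 0`, with the envelope `∏_{n∈]i,j]}(1 + C_n) ≤ Λ(1 + Cs)^{j−i}` along
the steps `i ≤ j < K`, `Λ ≥ 1`): two pinned runs of (0.20) in the box, the
read-out `betaMismatch β gA gB j ≤ q·s_j`, `TwoRunRenewal a ℓ′ ρ M gA gB s K`, the weight sum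
`Σ_{i≤K} (g^A_i)²g^B_{i+1} ≤ U`, the gap `(1 + Cs)ω < ρ < 1` and the window `q·Λ·ℓ′U ≤ (1 − (1 + Cs)ω)/2`; then with
`κ = Λρ/(ρ − (1 + Cs)ω)`: `disc gA gB j ≤ 2qaκ(1 − ρ)⁻¹ρ^j` (`j ≤ K`) and
`s_j ≤ (aκ + Λℓ′U·2qaκ(1 − ρ)⁻¹)ρ^j` (`j < K`).  (`twoPoint_fixedPoint_env` with `p = 0`,
`e_j = ℓ′(g^A_j)²g^B_{j+1}` via `T4CouplingMatching.abs_sub_le_of_inv_sq` and the printed step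
`T4TwoRunMatching.disc_step_twoRun`.) [folklore] -/
theorem disc_le_of_twoRun_env {β : HBeta} {K : ℕ} {gA gB s C : ℕ → ℝ} {M : ℕ → ℕ → ℝ}
    {γ a ℓ' q Cs Λ ω ρ U : ℝ}
    (hρ1 : ρ < 1) (hω : 0 ≤ ω) (hCs : 0 ≤ Cs) (hsmall : (1 + Cs) * ω < ρ)
    (ha : 0 ≤ a) (hℓ' : 0 ≤ ℓ') (hq : 0 ≤ q)
    (hA : RGEqH K β gA) (hB : RGEqH (K + 1) β gB)
    (hAbox : ∀ i, i ≤ K → 0 < gA i ∧ gA i ≤ γ) (hBbox : ∀ i, i ≤ K + 1 → 0 < gB i ∧ gB i ≤ γ)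
    (hpin : gA K = gB (K + 1))
    (hread : ∀ j, j < K → betaMismatch β gA gB j ≤ q * s j)
    (hren : TwoRunRenewal a ℓ' ρ M gA gB s K) (hs : ∀ j, j < K → 0 ≤ s j)
    (hC : ∀ j, 0 ≤ C j) (hΛ1 : 1 ≤ Λ)
    (hEnv : ∀ i j, i ≤ j → j < K → ∏ n ∈ Ico (i + 1) (j + 1), (1 + C n) ≤ Λ * (1 + Cs) ^ (j - i))
    (hM : ∀ j i, i < j → 0 ≤ M j i ∧ M j i ≤ C j * ω ^ (j - i))
    (hU : ∑ i ∈ range (K + 1), (gA i) ^ 2 * gB (i + 1) ≤ U)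
    (hwin : q * Λ * (ℓ' * U) ≤ (1 - (1 + Cs) * ω) / 2) :
    (∀ j, j ≤ K → disc gA gB j
        ≤ 2 * (q * a * (Λ * (ρ / (ρ - (1 + Cs) * ω)))) / (1 - ρ) * ρ ^ j) ∧
    (∀ j, j < K → s j ≤ (a * (Λ * (ρ / (ρ - (1 + Cs) * ω)))
        + Λ * (ℓ' * U) * (2 * (q * a * (Λ * (ρ / (ρ - (1 + Cs) * ω)))) / (1 - ρ)))
          * ρ ^ j) := by
  have he : ∀ j, j < K → 0 ≤ ℓ' * ((gA j) ^ 2 * gB (j + 1)) := fun j hj =>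
    mul_nonneg hℓ' (mul_nonneg (sq_nonneg _) (hBbox (j + 1) (by omega)).1.le)
  have hU' : ∑ j ∈ range K, ℓ' * ((gA j) ^ 2 * gB (j + 1)) ≤ ℓ' * U := by
    rw [← Finset.mul_sum]
    refine mul_le_mul_of_nonneg_left (le_trans ?_ hU) hℓ'
    exact Finset.sum_le_sum_of_subset_of_nonneg (Finset.range_mono (Nat.le_succ K))
      (fun i hi _ => mul_nonneg (sq_nonneg _) (hBbox (i + 1) (by have := mem_range.mp hi; omega)).1.le)
  have hback : ∀ j, j < K → disc gA gB j ≤ disc gA gB (j + 1) + 0 * ρ ^ j + q * s j := by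
    intro j hj
    have h1 := disc_step_twoRun hA hB hj
    have h3 := hread j hj
    rw [zero_mul, add_zero]
    linarith
  have hfwd : ∀ j, j < K →
      s j ≤ a * ρ ^ j + ℓ' * ((gA j) ^ 2 * gB (j + 1)) * disc gA gB j + ∑ i ∈ range j, M j i * s i := by
    intro j hj
    have h1 := hren j hj
    have hgA := hAbox j hj.le
    have hgB := hBbox (j + 1) (by omega)
    have h2 : ℓ' * |gA j - gB (j + 1)| ≤ ℓ' * ((gA j) ^ 2 * gB (j + 1)) * disc gA gB j := by
      rw [mul_assoc]
      exact mul_le_mul_of_nonneg_left (abs_sub_le_of_inv_sq hgA.1 hgB.1) hℓ'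
    linarith
  have h := twoPoint_fixedPoint_env (δ := disc gA gB) (e := fun j => ℓ' * ((gA j) ^ 2 * gB (j + 1)))
    (U := ℓ' * U) (p := 0) (q := q)
    hρ1 hω hCs hsmall ha le_rfl hq (disc_nonneg gA gB) hs he hU' hC hΛ1 hEnv hM (disc_pin hpin) hback hfwd hwin
  simp only [zero_add] at h
  exact h

/-- **THE TWO-POINT SYSTEM WITH THE FULL MISMATCH READ OUT — AF-TAIL (COUNT) FORM**: `disc_le_of_twoRun_env` with
the count dictionary `env_le_count` (`0 ≤ C_j ≤ Cb`, `C_j ≤ Cs` at all but at most `N` of the steps `j < K`,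
`Λ = (1 + Cb)^N`). [folklore] -/
theorem disc_le_of_twoRun_afTail {β : HBeta} {K N : ℕ} {gA gB s C : ℕ → ℝ} {M : ℕ → ℕ → ℝ}
    {γ a ℓ' q Cs Cb ω ρ U : ℝ}
    (hρ1 : ρ < 1) (hω : 0 ≤ ω) (hCs : 0 ≤ Cs) (hsmall : (1 + Cs) * ω < ρ)
    (ha : 0 ≤ a) (hℓ' : 0 ≤ ℓ') (hq : 0 ≤ q)
    (hA : RGEqH K β gA) (hB : RGEqH (K + 1) β gB)
    (hAbox : ∀ i, i ≤ K → 0 < gA i ∧ gA i ≤ γ) (hBbox : ∀ i, i ≤ K + 1 → 0 < gB i ∧ gB i ≤ γ)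
    (hpin : gA K = gB (K + 1))
    (hread : ∀ j, j < K → betaMismatch β gA gB j ≤ q * s j)
    (hren : TwoRunRenewal a ℓ' ρ M gA gB s K) (hs : ∀ j, j < K → 0 ≤ s j)
    (hC : ∀ j, 0 ≤ C j) (hCb : ∀ j, C j ≤ Cb) (hN : ((range K).filter (fun j => Cs < C j)).card ≤ N)
    (hM : ∀ j i, i < j → 0 ≤ M j i ∧ M j i ≤ C j * ω ^ (j - i))
    (hU : ∑ i ∈ range (K + 1), (gA i) ^ 2 * gB (i + 1) ≤ U)
    (hwin : q * (1 + Cb) ^ N * (ℓ' * U) ≤ (1 - (1 + Cs) * ω) / 2) :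
    (∀ j, j ≤ K → disc gA gB j
        ≤ 2 * (q * a * ((1 + Cb) ^ N * (ρ / (ρ - (1 + Cs) * ω)))) / (1 - ρ) * ρ ^ j) ∧
    (∀ j, j < K → s j ≤ (a * ((1 + Cb) ^ N * (ρ / (ρ - (1 + Cs) * ω)))
        + (1 + Cb) ^ N * (ℓ' * U) * (2 * (q * a * ((1 + Cb) ^ N * (ρ / (ρ - (1 + Cs) * ω)))) / (1 - ρ)))
          * ρ ^ j) :=
  disc_le_of_twoRun_env hρ1 hω hCs hsmall ha hℓ' hq hA hB hAbox hBbox hpin hread hren hs hC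
    (one_le_pow₀ (by linarith [(hC 0).trans (hCb 0)])) (env_le_count hC hCb hCs hN) hM hU hwin

end RunLevel

/-! ## §4 ORIENTATION of the asymptotic-freedom tail along a run of (0.20): the exceptional steps sit at the
INFRARED END (the last scales before the unit lattice) and at the first `k₀` scales; their NUMBER is K-uniform -/

section Orientation

/-- ALONG A RUN OF (0.20) THE COUPLINGS INCREASE TOWARD THE PIN: with an eventual lower bound `b ≤ β_{i+1}`, `b > 0`, on
the boxes (`EventualLowerH b γ k₀ β` — UNPRINTED input, the (AF-0r)/tail-lower shape), `g_i < g_{i+1}` for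
`k₀ ≤ i < K` (`1/g_i² = 1/g_{i+1}² + β_{i+1} ≥ 1/g_{i+1}² + b`, (0.20)).  So the flag index runs FROM the ultraviolet end
(step 0 = the finest lattice, [Balaban1987RG1] p. 256 «ε = L^{−K} … k = 0, 1, …, K») TO the unit lattice, and a
hypothesis `g (n+1) ≤ g n` along the flag index (as in `T4FlagMemoryAF.sh_le_of_af_tail` /
`dist_entry_le_of_af_tail`) is met by NO run of (0.20) on this branch beyond the scale `k₀`.  PROVENANCE (v1.2): the
observation is the referee's, cell GAPS G-t4r3-1 (seat t4-ref3-g5), acknowledged by the owner lineage in `T4FlagMemoryAF`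
v1.1 (p186434: §6 relabelled «non-increasing-run tail», §9 orientation lemmas); this theorem is the SAME Prop as
`T4FlagMemoryAF.lt_succ_of_rgEqH_lower` (v1.1 §9) — a DUPLICATE kept for name stability (§4–§5 of this file cite it);
downstream modules may cite either name. [cite: Balaban1987RG1, (0.20) p.256 and (0.31) p.259] -/
theorem lt_succ_of_eventualLower {β : HBeta} {γ b : ℝ} {k₀ K : ℕ} {g : ℕ → ℝ} (hb : 0 < b) (h : RGEqH K β g)
    (hbox : ∀ i, i ≤ K → 0 < g i ∧ g i ≤ γ) (hlo : EventualLowerH b γ k₀ β) {i : ℕ} (hk : k₀ ≤ i)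
    (hi : i < K) : g i < g (i + 1) := by
  have hrec := h i hi
  have hβ : b ≤ β i (prefixOf g i) := hlo i _ hk (prefixOf_mem_box hi.le hbox)
  have hgi := (hbox i hi.le).1
  have hgi1 := (hbox (i + 1) hi).1
  have hlt : 1 / (g (i + 1)) ^ 2 < 1 / (g i) ^ 2 := by linarith
  have hsq : (g i) ^ 2 < (g (i + 1)) ^ 2 := (one_div_lt_one_div (pow_pos hgi1 2) (pow_pos hgi 2)).mp hlt
  exact lt_of_pow_lt_pow_left₀ 2 hgi1.le hsq

/-- THE ASYMPTOTIC-FREEDOM TAIL IS AT THE ULTRAVIOLET END: along a run of (0.20) in the box with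
`EventualLowerH b γ k₀ β`, for `k₀ ≤ i ≤ K`: `b·(K − i)·g_i² ≤ 1` — the coupling at scale `i` is small in terms of the
NUMBER OF SCALES `K − i` STILL TO GO before the unit lattice (`T4CouplingMatching.inv_sq_lower_of_eventualLower`), not
in terms of `i`. [cite: Balaban1987RG1, (0.31) p.259] -/
theorem sq_mul_le_one_of_eventualLower {β : HBeta} {γ b : ℝ} {k₀ K : ℕ} {g : ℕ → ℝ} (h : RGEqH K β g)
    (hbox : ∀ i, i ≤ K → 0 < g i ∧ g i ≤ γ) (hlo : EventualLowerH b γ k₀ β) {i : ℕ} (hk : k₀ ≤ i) (hi : i ≤ K) :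
    b * ((K - i : ℕ) : ℝ) * (g i) ^ 2 ≤ 1 := by
  have h1 := inv_sq_lower_of_eventualLower h hbox hlo hk hi
  have hgi := (hbox i hi).1
  have hgK := (hbox K le_rfl).1
  have h2 : 0 ≤ 1 / (g K) ^ 2 := by positivity
  have h3 : b * ((K - i : ℕ) : ℝ) ≤ 1 / (g i) ^ 2 := by linarith
  rwa [le_div_iff₀ (pow_pos hgi 2)] at h3

/-- **THE COUNT OF EXCEPTIONAL STEPS IS K-UNIFORM.**  Along a run of (0.20) in the box with `EventualLowerH b γ k₀ β`,
`b > 0`: for every `ε > 0` and `c ≥ 0`, the steps `j < K` at which the coupling-weighted constant `c·g_j` exceeds `ε`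
are among the first `k₀` and the LAST `⌈c²/(bε²)⌉` before the unit scale, so
`#{j < K : ε < c·g_j} ≤ k₀ + ⌈c²/(bε²)⌉₊` — independent of `K` (and of their position, which is all §2 needs).
[cite: Balaban1987RG1, (0.31) p.259] -/
theorem card_filter_coupling_le {β : HBeta} {γ b c ε : ℝ} {k₀ K : ℕ} {g : ℕ → ℝ} (hb : 0 < b)
    (hε : 0 < ε) (h : RGEqH K β g) (hbox : ∀ i, i ≤ K → 0 < g i ∧ g i ≤ γ) (hlo : EventualLowerH b γ k₀ β) :
    ((range K).filter (fun j => ε < c * g j)).card ≤ k₀ + ⌈c ^ 2 / (b * ε ^ 2)⌉₊ := by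
  set n₀ := ⌈c ^ 2 / (b * ε ^ 2)⌉₊ with hn₀
  have hsub : (range K).filter (fun j => ε < c * g j) ⊆ range k₀ ∪ Ico (K - n₀) K := by
    intro j hj
    rw [Finset.mem_filter, Finset.mem_range] at hj
    obtain ⟨hjK, hεj⟩ := hj
    rw [Finset.mem_union, Finset.mem_range, Finset.mem_Ico]
    by_cases hjk : j < k₀
    · exact Or.inl hjk
    · right
      refine ⟨?_, hjK⟩
      have hk : k₀ ≤ j := not_lt.mp hjk
      have h1 := sq_mul_le_one_of_eventualLower h hbox hlo hk hjK.le
      have hgj := (hbox j hjK.le).1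
      have hcg : 0 < c * g j := hε.trans hεj
      have hc0 : 0 < c := (mul_pos_iff_of_pos_right hgj).mp hcg
      have h2 : ε ^ 2 < c ^ 2 * (g j) ^ 2 := by
        rw [← mul_pow]; exact pow_lt_pow_left₀ hεj hε.le two_ne_zero
      have h3 : ((K - j : ℕ) : ℝ) * (b * ε ^ 2) < c ^ 2 := by
        rcases Nat.eq_zero_or_pos (K - j) with hz | hpos
        · rw [hz, Nat.cast_zero, zero_mul]; exact pow_pos hc0 2
        · have hKj' : (0 : ℝ) < ((K - j : ℕ) : ℝ) := by exact_mod_cast hpos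
          have h5 : ((K - j : ℕ) : ℝ) * (b * ε ^ 2) < ((K - j : ℕ) : ℝ) * (b * (c ^ 2 * (g j) ^ 2)) :=
            mul_lt_mul_of_pos_left (mul_lt_mul_of_pos_left h2 hb) hKj'
          have h6 : ((K - j : ℕ) : ℝ) * (b * (c ^ 2 * (g j) ^ 2))
              = c ^ 2 * (b * ((K - j : ℕ) : ℝ) * (g j) ^ 2) := by ring
          have h7 : c ^ 2 * (b * ((K - j : ℕ) : ℝ) * (g j) ^ 2) ≤ c ^ 2 * 1 :=
            mul_le_mul_of_nonneg_left h1 (sq_nonneg c)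
          linarith
      have h3' : ((K - j : ℕ) : ℝ) < c ^ 2 / (b * ε ^ 2) := by
        rw [lt_div_iff₀ (by positivity)]; exact h3
      have h4 : K - j < n₀ := by rw [hn₀]; exact Nat.lt_ceil.mpr h3'
      omega
  calc ((range K).filter (fun j => ε < c * g j)).card ≤ (range k₀ ∪ Ico (K - n₀) K).card :=
        Finset.card_le_card hsub
    _ ≤ (range k₀).card + (Ico (K - n₀) K).card := Finset.card_union_le _ _
    _ ≤ k₀ + n₀ := by rw [Finset.card_range, Nat.card_Ico]; omega

/-- `Σ_{m=1}^{n} 1/√m ≤ 2√n` (`1/√(m+1) ≤ 2(√(m+1) − √m)`, telescoping). [folklore] -/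
theorem sum_Ico_inv_sqrt_le (n : ℕ) :
    ∑ m ∈ Ico 1 (n + 1), 1 / Real.sqrt (m : ℝ) ≤ 2 * Real.sqrt (n : ℝ) := by
  induction n with
  | zero => simp
  | succ n ih =>
    rw [Finset.sum_Ico_succ_top (by omega : 1 ≤ n + 1), Nat.cast_succ]
    have ha0 : 0 < Real.sqrt ((n : ℝ) + 1) := Real.sqrt_pos.mpr (by positivity)
    have ha2 : Real.sqrt ((n : ℝ) + 1) ^ 2 = (n : ℝ) + 1 := Real.sq_sqrt (by positivity)
    have hb2 : Real.sqrt (n : ℝ) ^ 2 = (n : ℝ) := Real.sq_sqrt (Nat.cast_nonneg n)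
    have hba : Real.sqrt (n : ℝ) ≤ Real.sqrt ((n : ℝ) + 1) := Real.sqrt_le_sqrt (by linarith)
    have hkey : 1 / Real.sqrt ((n : ℝ) + 1) ≤ 2 * (Real.sqrt ((n : ℝ) + 1) - Real.sqrt (n : ℝ)) := by
      rw [div_le_iff₀ ha0]
      nlinarith [sq_nonneg (Real.sqrt ((n : ℝ) + 1) - Real.sqrt (n : ℝ))]
    linarith

/-- THE INFRARED EXCEPTIONAL BLOCK, scale by scale: along a run of (0.20) in the box with `EventualLowerH b γ k₀ β`,
`b > 0`, a step `k₀ ≤ j < K` with `c·g_j > ε > 0` lies within the last `⌈c²/(bε²)⌉` scales, `K − ⌈c²/(bε²)⌉₊ ≤ j`, and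
there `g_j ≤ 1/√(b(K − j))`. [cite: Balaban1987RG1, (0.31) p.259] -/
theorem ir_block_of_exceptional {β : HBeta} {γ b c ε : ℝ} {k₀ K : ℕ} {g : ℕ → ℝ} (hb : 0 < b) (hε : 0 < ε)
    (h : RGEqH K β g) (hbox : ∀ i, i ≤ K → 0 < g i ∧ g i ≤ γ) (hlo : EventualLowerH b γ k₀ β) {j : ℕ}
    (hk : k₀ ≤ j) (hjK : j < K) (hεj : ε < c * g j) :
    K - ⌈c ^ 2 / (b * ε ^ 2)⌉₊ ≤ j ∧ g j ≤ 1 / Real.sqrt (b * ((K - j : ℕ) : ℝ)) := by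
  have h1 := sq_mul_le_one_of_eventualLower h hbox hlo hk hjK.le
  have hgj := (hbox j hjK.le).1
  have hcg : 0 < c * g j := hε.trans hεj
  have hc0 : 0 < c := (mul_pos_iff_of_pos_right hgj).mp hcg
  have hKj' : (0 : ℝ) < ((K - j : ℕ) : ℝ) := by exact_mod_cast (show 0 < K - j by omega)
  refine ⟨?_, ?_⟩
  · have h2 : ε ^ 2 < c ^ 2 * (g j) ^ 2 := by
      rw [← mul_pow]; exact pow_lt_pow_left₀ hεj hε.le two_ne_zero
    have h5 : ((K - j : ℕ) : ℝ) * (b * ε ^ 2) < ((K - j : ℕ) : ℝ) * (b * (c ^ 2 * (g j) ^ 2)) :=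
      mul_lt_mul_of_pos_left (mul_lt_mul_of_pos_left h2 hb) hKj'
    have h6 : ((K - j : ℕ) : ℝ) * (b * (c ^ 2 * (g j) ^ 2)) = c ^ 2 * (b * ((K - j : ℕ) : ℝ) * (g j) ^ 2) := by
      ring
    have h7 : c ^ 2 * (b * ((K - j : ℕ) : ℝ) * (g j) ^ 2) ≤ c ^ 2 * 1 :=
      mul_le_mul_of_nonneg_left h1 (sq_nonneg c)
    have h3 : ((K - j : ℕ) : ℝ) < c ^ 2 / (b * ε ^ 2) := by
      rw [lt_div_iff₀ (by positivity)]; linarith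
    have h4 : K - j < ⌈c ^ 2 / (b * ε ^ 2)⌉₊ := Nat.lt_ceil.mpr h3
    omega
  · have hpos : 0 < b * ((K - j : ℕ) : ℝ) := mul_pos hb hKj'
    have hsq : (g j) ^ 2 ≤ (b * ((K - j : ℕ) : ℝ))⁻¹ := by
      rw [inv_eq_one_div, le_div_iff₀ hpos]
      have e : (g j) ^ 2 * (b * ((K - j : ℕ) : ℝ)) = b * ((K - j : ℕ) : ℝ) * (g j) ^ 2 := by ring
      linarith
    calc g j = Real.sqrt ((g j) ^ 2) := (Real.sqrt_sq hgj.le).symm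
      _ ≤ Real.sqrt ((b * ((K - j : ℕ) : ℝ))⁻¹) := Real.sqrt_le_sqrt hsq
      _ = 1 / Real.sqrt (b * ((K - j : ℕ) : ℝ)) := by rw [Real.sqrt_inv, one_div]

/-- **THE SUM DICTIONARY ALONG A RUN OF (0.20): the product of the exceptional step factors is K-UNIFORM.**
Under `EventualLowerH b γ k₀ β` (`b > 0`), in the box, for `ε > 0`, `c ≥ 0`:
`∏_{j<K, c·g_j>ε} (1 + c·g_j) ≤ (1 + cγ)^{k₀} · exp(2c·√⌈c²/(bε²)⌉ / √b)` — the first `k₀` scales cost a factor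
`1 + cγ` each; on the infrared block the couplings are square-root-summable in the number of scales to go
(`ir_block_of_exceptional`, `sum_Ico_inv_sqrt_le`).  With `env_le_prod_bad` this is the envelope constant `Λ` of
`twoPoint_fixedPoint_env` WITHOUT the factor `(1 + cγ)^{⌈c²/(bε²)⌉}` of the count dictionary
(`card_filter_coupling_le`): sharper exactly when `cγ > 2ε·(…)`, i.e. when the coupling-weighted constant at the unit
scale is NOT small against the gap — the regime the AF-tail form is for. [cite: Balaban1987RG1, (0.31) p.259] -/
theorem prod_exceptional_coupling_le {β : HBeta} {γ b c ε : ℝ} {k₀ K : ℕ} {g : ℕ → ℝ} (hb : 0 < b) (hc : 0 ≤ c)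
    (hε : 0 < ε) (h : RGEqH K β g) (hbox : ∀ i, i ≤ K → 0 < g i ∧ g i ≤ γ) (hlo : EventualLowerH b γ k₀ β) :
    ∏ j ∈ (range K).filter (fun j => ε < c * g j), (1 + c * g j)
      ≤ (1 + c * γ) ^ k₀ * Real.exp (2 * c * Real.sqrt (⌈c ^ 2 / (b * ε ^ 2)⌉₊ : ℝ) / Real.sqrt b) := by
  set n₀ := ⌈c ^ 2 / (b * ε ^ 2)⌉₊ with hn₀
  have hγ : 0 < γ := (hbox 0 (Nat.zero_le K)).1.trans_le (hbox 0 (Nat.zero_le K)).2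
  have hcγ : (1 : ℝ) ≤ 1 + c * γ := by nlinarith
  have hF : ∀ j ∈ (range K).filter (fun j => ε < c * g j), j < K ∧ ε < c * g j := fun j hj => by
    simpa [Finset.mem_filter] using hj
  rw [← Finset.prod_filter_mul_prod_filter_not ((range K).filter (fun j => ε < c * g j)) (fun j => j < k₀)]
  refine mul_le_mul ?_ ?_ (Finset.prod_nonneg fun j hj => ?_) (pow_nonneg (by linarith) _)
  · -- the first k₀ scales
    calc ∏ j ∈ ((range K).filter (fun j => ε < c * g j)).filter (fun j => j < k₀), (1 + c * g j)
        ≤ ∏ j ∈ ((range K).filter (fun j => ε < c * g j)).filter (fun j => j < k₀), (1 + c * γ) := by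
          refine Finset.prod_le_prod (fun j hj => ?_) (fun j hj => ?_)
          · have hj' := hF j (Finset.mem_filter.mp hj).1
            linarith [mul_nonneg hc (hbox j hj'.1.le).1.le]
          · have hj' := hF j (Finset.mem_filter.mp hj).1
            linarith [mul_le_mul_of_nonneg_left (hbox j hj'.1.le).2 hc]
      _ = (1 + c * γ) ^ (((range K).filter (fun j => ε < c * g j)).filter (fun j => j < k₀)).card :=
          Finset.prod_const _
      _ ≤ (1 + c * γ) ^ k₀ := by
          refine pow_le_pow_right₀ hcγ ?_
          calc (((range K).filter (fun j => ε < c * g j)).filter (fun j => j < k₀)).card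
              ≤ (range k₀).card := Finset.card_le_card fun j hj => by
                exact Finset.mem_range.mpr (Finset.mem_filter.mp hj).2
            _ = k₀ := Finset.card_range k₀
  · -- the infrared exceptional block
    set T := ((range K).filter (fun j => ε < c * g j)).filter (fun j => ¬ j < k₀) with hT
    have hTmem : ∀ j ∈ T, k₀ ≤ j ∧ j < K ∧ ε < c * g j := fun j hj => by
      obtain ⟨hj1, hj2⟩ := Finset.mem_filter.mp hj
      exact ⟨not_lt.mp hj2, hF j hj1⟩
    have hsumT : ∑ j ∈ T, c * g j ≤ 2 * c * Real.sqrt (n₀ : ℝ) / Real.sqrt b := by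
      have h1 : ∑ j ∈ T, c * g j ≤ ∑ j ∈ T, c * (1 / Real.sqrt (b * ((K - j : ℕ) : ℝ))) := by
        refine Finset.sum_le_sum fun j hj => ?_
        obtain ⟨hk, hjK, hεj⟩ := hTmem j hj
        exact mul_le_mul_of_nonneg_left (ir_block_of_exceptional hb hε h hbox hlo hk hjK hεj).2 hc
      have hTsub : T ⊆ Ico (K - n₀) K := fun j hj => by
        obtain ⟨hk, hjK, hεj⟩ := hTmem j hj
        exact Finset.mem_Ico.mpr ⟨(ir_block_of_exceptional hb hε h hbox hlo hk hjK hεj).1, hjK⟩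
      have h2 : ∑ j ∈ T, c * (1 / Real.sqrt (b * ((K - j : ℕ) : ℝ)))
          ≤ ∑ j ∈ Ico (K - n₀) K, c * (1 / Real.sqrt (b * ((K - j : ℕ) : ℝ))) :=
        Finset.sum_le_sum_of_subset_of_nonneg hTsub fun j _ _ => by positivity
      have h3 : ∑ j ∈ Ico (K - n₀) K, c * (1 / Real.sqrt (b * ((K - j : ℕ) : ℝ)))
          = c * ∑ m ∈ Ico 1 (K - (K - n₀) + 1), 1 / Real.sqrt (b * (m : ℝ)) := by
        rw [← Finset.mul_sum]
        congr 1
        have hrefl := Finset.sum_Ico_reflect (fun x : ℕ => 1 / Real.sqrt (b * (x : ℝ))) (K - n₀)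
          (m := K) (n := K) (Nat.le_succ K)
        rw [show K + 1 - K = 1 by omega, show K + 1 - (K - n₀) = K - (K - n₀) + 1 by omega] at hrefl
        exact hrefl
      have h4 : ∑ m ∈ Ico 1 (K - (K - n₀) + 1), 1 / Real.sqrt (b * (m : ℝ))
          = (1 / Real.sqrt b) * ∑ m ∈ Ico 1 (K - (K - n₀) + 1), 1 / Real.sqrt (m : ℝ) := by
        rw [Finset.mul_sum]
        refine Finset.sum_congr rfl fun m _ => ?_
        rw [Real.sqrt_mul hb.le]
        field_simp
      have h5 := sum_Ico_inv_sqrt_le (K - (K - n₀))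
      have h6 : Real.sqrt ((K - (K - n₀) : ℕ) : ℝ) ≤ Real.sqrt (n₀ : ℝ) :=
        Real.sqrt_le_sqrt (by exact_mod_cast (show K - (K - n₀) ≤ n₀ by omega))
      have hb' : 0 < 1 / Real.sqrt b := by positivity
      calc ∑ j ∈ T, c * g j ≤ c * ((1 / Real.sqrt b) * ∑ m ∈ Ico 1 (K - (K - n₀) + 1), 1 / Real.sqrt (m : ℝ)) := by
            rw [← h4, ← h3]; exact h1.trans h2
        _ ≤ c * ((1 / Real.sqrt b) * (2 * Real.sqrt (n₀ : ℝ))) :=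
            mul_le_mul_of_nonneg_left (mul_le_mul_of_nonneg_left (h5.trans (by linarith)) hb'.le) hc
        _ = 2 * c * Real.sqrt (n₀ : ℝ) / Real.sqrt b := by ring
    calc ∏ j ∈ T, (1 + c * g j) ≤ Real.exp (∑ j ∈ T, c * g j) :=
          prod_one_add_le_exp_sum T fun j hj => mul_nonneg hc (hbox j (hTmem j hj).2.1.le).1.le
      _ ≤ Real.exp (2 * c * Real.sqrt (n₀ : ℝ) / Real.sqrt b) := Real.exp_le_exp.mpr hsumT
  · have hj' := hF j (Finset.mem_filter.mp hj).1
    linarith [mul_nonneg hc (hbox j hj'.1.le).1.le]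

end Orientation

/-! ## §5 Scheme level: node U2's output from the coupling-weighted memory `T4FlagMemoryAF.StepMemoryFn Φ γ (c·) ω`
read ALONG THE RUNS — the memory gap against `(1 + ε)ω` for ANY `ε > 0`, the price a K-uniform power of `1 + cγ` -/

section SchemeLevel

variable {X : Type*} [PseudoMetricSpace X] [Inhabited X]

open Literature.MathematicalPhysics.QuantumFieldTheory.Balaban1983to89.T4FlagMemoryAF (StepMemoryFn)

/-- **NODE U2's OUTPUT FROM THE FULL SCHEME WITH COUPLING-WEIGHTED MEMORY, FED RUN-WISE.**
As `T4TwoRunClosure.injectedRate_of_fullScheme_twoRun_af` (represented history-dependent family `β`, read-out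
`ReadLipschitz r cr`, `StepDirect Φ ℓ′ γ`, `StepShift Φ γ src` with `src k ≤ aρ^k`, all runs of (0.20) in the box and
pinned at one infrared value, `EventualLowerH b γ k₀ β` with `b, γ > 0`), but with the memory pair
`StepMemory Φ M′` + `FadingMemory C′ ω M′` (ONE constant `C′` at every coupling, gap `(1 + C′)ω < ρ`) REPLACED by the
coupling-weighted shape `T4FlagMemoryAF.StepMemoryFn Φ γ (c·) ω` of P1 (memory constant `c·g` at coupling `g`; the
located reading of [Balaban1988RG2Cluster] p. 8 «use the expression g_k|B| instead of ε₁»).  CONCLUSION: for EVERY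
`ε > 0` with `(1 + ε)ω < ρ < 1` and the window
`cr·ℓ′·(1 + cγ)^{k₀ + ⌈c²/(bε²)⌉}·((k₀+1)γ³ + 2γ/b) ≤ (1 − (1 + ε)ω)/2`, the coupling discrepancies carry the source's
rate: `InjectedRate (2·cr·a·Λ·ρ/(ρ − (1+ε)ω)·(1 − ρ)⁻¹) 0 ρ`, `Λ = (1 + cγ)^{k₀ + ⌈c²/(bε²)⌉}` — the box constant `cγ`
has LEFT THE GAP (it was `(1 + cγ)ω < ρ` in every box-uniform form: `T4FlagMemoryAF.injectedRate_of_scheme_twoRun_af`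
(and its `_pinned` / `injectedRate_of_split_scheme_eventual_af_pinned` forms),
`T4TwoRunClosure` §6 with `C′ = cγ`) and enters only through the K-UNIFORM power `Λ`.  MECHANISM (§4): along each run
the steps with `c·g_j > ε` are the first `k₀` and the last `⌈c²/(bε²)⌉` before the unit scale
(`card_filter_coupling_le`) — at the INFRARED end, where `g_j ↑ gIR`; §2 needs only their number.  HONEST LIMITS:
(i) every scheme hypothesis is an UNPRINTED shape (headers of `T4FlagMemory`, `T4FlagMemoryAF`), the window is a
smallness condition on `γ` given `c, b, k₀, ε` (it holds for `γ` small since `Λ → (1+0)^{…}`-bounded as `γ → 0` only if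
`c²/(bε²)` is held fixed — `b` is tied to `γ` through (AF-0r), so the window is a genuine JOINT condition, not automatic);
(ii) with `ε ≥ cγ` the count is `≤ k₀`-free of `ε` and the statement is the box-uniform one up to constants; (iii) rung
(B)+1 of the finite-T⁴ ladder only — NOT infinite volume, NOT a mass gap, NOT the Clay problem; nothing of
[Balaban1987RG1]/[Balaban1988RG2Cluster] is asserted. [cite: Balaban1987RG1, (0.20) p.256 and Thm 2 p.259] -/
theorem injectedRate_of_fullScheme_twoRun_afTail {β : HBeta} {Φ : ℕ → ℝ → (ℕ → X) → X} {r : X → ℝ}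
    {src : ℕ → ℝ} {ℓ' c ω γ cr a ρ b ε : ℝ} {k₀ : ℕ} (g : ℕ → ℕ → ℝ) (gIR : ℝ)
    (hγ : 0 < γ) (hb : 0 < b) (hρ1 : ρ < 1)
    (hℓ' : 0 ≤ ℓ') (hc : 0 ≤ c) (hω : 0 ≤ ω) (hcr : 0 ≤ cr) (ha : 0 ≤ a) (hε : 0 < ε)
    (hgap : (1 + ε) * ω < ρ)
    (hrep : Represents Φ r γ β) (hr : ReadLipschitz r cr) (hdir : StepDirect Φ ℓ' γ)
    (hmem : StepMemoryFn Φ γ (fun x => c * x) ω) (hsh : StepShift Φ γ src)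
    (hsrc : ∀ k, src k ≤ a * ρ ^ k)
    (hrun : ∀ K, RGEqH K β (g K)) (hbox : ∀ K i, i ≤ K → 0 < g K i ∧ g K i ≤ γ)
    (hpin : ∀ K, g K K = gIR) (hlo : EventualLowerH b γ k₀ β)
    (hwin : cr * ℓ' * (1 + c * γ) ^ (k₀ + ⌈c ^ 2 / (b * ε ^ 2)⌉₊) * (((k₀ : ℝ) + 1) * γ ^ 3 + 2 * γ / b)
      ≤ (1 - (1 + ε) * ω) / 2) :
    T4CauchySum.InjectedRate
      (2 * (cr * (a * ((1 + c * γ) ^ (k₀ + ⌈c ^ 2 / (b * ε ^ 2)⌉₊) * (ρ / (ρ - (1 + ε) * ω))))) / (1 - ρ))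
      0 ρ (fun K j => disc (g K) (g (K + 1)) j) := by
  intro K j hj
  refine ⟨disc_nonneg _ _ _, ?_⟩
  set N := k₀ + ⌈c ^ 2 / (b * ε ^ 2)⌉₊ with hN
  -- the step constants read along run A = g K (clamped beyond K, so that 0 ≤ C_j ≤ cγ everywhere)
  set C : ℕ → ℝ := fun j => c * extd (prefixOf (g K) K) j with hC
  have hadm : Adm γ (extd (prefixOf (g K) K)) := extd_adm (prefixOf_mem_box le_rfl (hbox K))
  have hC0 : ∀ j, 0 ≤ C j := fun j => mul_nonneg hc (hadm j).1.le
  have hCb : ∀ j, C j ≤ c * γ := fun j => mul_le_mul_of_nonneg_left (hadm j).2 hc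
  have hCj : ∀ j, j < K → C j = c * g K j := fun j hj => by simp only [hC, extd_prefixOf hj.le]
  have hcount : ((range K).filter (fun j => ε < C j)).card ≤ N := by
    have e1 : (range K).filter (fun j => ε < C j) = (range K).filter (fun j => ε < c * g K j) :=
      Finset.filter_congr fun j hj => by rw [hCj j (mem_range.mp hj)]
    rw [e1]
    exact card_filter_coupling_le hb hε (hrun K) (hbox K) hlo
  have hmemA : ∀ j (y y' : ℕ → X), j < K →
      dist (Φ j (g K j) y) (Φ j (g K j) y') ≤ ∑ m ∈ range j, C j * ω ^ (j - m) * dist (y m) (y' m) := by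
    intro j y y' hj
    rw [hCj j hj]
    exact hmem j (g K j) y y' (hbox K j hj.le).1 (hbox K j hj.le).2
  have hren := twoRunRenewal_of_scheme_runwise hdir hmemA hsh hsrc (hbox K) (hbox (K + 1))
  have hM : ∀ j i, i < j → 0 ≤ C j * ω ^ (j - i) ∧ C j * ω ^ (j - i) ≤ C j * ω ^ (j - i) :=
    fun j i _ => ⟨mul_nonneg (hC0 j) (pow_nonneg hω _), le_rfl⟩
  have hwin' : cr * (1 + c * γ) ^ N * (ℓ' * (((k₀ : ℝ) + 1) * γ ^ 3 + 2 * γ / b)) ≤ (1 - (1 + ε) * ω) / 2 := by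
    have e : cr * (1 + c * γ) ^ N * (ℓ' * (((k₀ : ℝ) + 1) * γ ^ 3 + 2 * γ / b))
        = cr * ℓ' * (1 + c * γ) ^ N * (((k₀ : ℝ) + 1) * γ ^ 3 + 2 * γ / b) := by ring
    rw [e]; exact hwin
  have h := (disc_le_of_twoRun_afTail hρ1 hω hε.le hgap ha hℓ' hcr (hrun K) (hrun (K + 1)) (hbox K)
    (hbox (K + 1)) ((hpin K).trans (hpin (K + 1)).symm)
    (betaMismatch_le_of_represents hrep hr (hbox K) (hbox (K + 1)))
    hren (fun j _ => pairDist_nonneg Φ (g K) (g (K + 1)) K j) hC0 hCb hcount hM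
    (sum_weights_le_of_eventualLower hγ hb (hrun K) (hrun (K + 1)) (hbox K) (hbox (K + 1)) hlo) hwin').1 j hj
  have h' : disc (g K) (g (K + 1)) j
      ≤ 2 * (cr * (a * ((1 + c * γ) ^ N * (ρ / (ρ - (1 + ε) * ω))))) / (1 - ρ) * ρ ^ j :=
    calc disc (g K) (g (K + 1)) j
        ≤ 2 * (cr * a * ((1 + c * γ) ^ N * (ρ / (ρ - (1 + ε) * ω)))) / (1 - ρ) * ρ ^ j := h
      _ = 2 * (cr * (a * ((1 + c * γ) ^ N * (ρ / (ρ - (1 + ε) * ω))))) / (1 - ρ) * ρ ^ j := by ring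
  simpa using h'

/-- **NODE U2's OUTPUT FROM THE FULL SCHEME WITH COUPLING-WEIGHTED MEMORY, FED RUN-WISE — SUM DICTIONARY.**
As `injectedRate_of_fullScheme_twoRun_afTail`, with the envelope constant of the SUM dictionary
(`prod_exceptional_coupling_le`): `Λ = (1 + cγ)^{k₀}·exp(2c√⌈c²/(bε²)⌉/√b)` in place of `(1 + cγ)^{k₀ + ⌈c²/(bε²)⌉}` —
no power of `1 + cγ` growing with `1/ε²`; window `cr·ℓ′·Λ·((k₀+1)γ³ + 2γ/b) ≤ (1 − (1 + ε)ω)/2`, conclusion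
`InjectedRate (2·cr·a·Λ·ρ/(ρ − (1+ε)ω)·(1 − ρ)⁻¹) 0 ρ`.  Same honest limits (unprinted scheme shapes; a joint smallness
condition on `γ` given `c, b, k₀, ε, cr, ℓ′, ω`; rung (B)+1 only). [cite: Balaban1987RG1, (0.20) p.256 and Thm 2 p.259] -/
theorem injectedRate_of_fullScheme_twoRun_afTail_sum {β : HBeta} {Φ : ℕ → ℝ → (ℕ → X) → X} {r : X → ℝ}
    {src : ℕ → ℝ} {ℓ' c ω γ cr a ρ b ε : ℝ} {k₀ : ℕ} (g : ℕ → ℕ → ℝ) (gIR : ℝ)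
    (hγ : 0 < γ) (hb : 0 < b) (hρ1 : ρ < 1)
    (hℓ' : 0 ≤ ℓ') (hc : 0 ≤ c) (hω : 0 ≤ ω) (hcr : 0 ≤ cr) (ha : 0 ≤ a) (hε : 0 < ε)
    (hgap : (1 + ε) * ω < ρ)
    (hrep : Represents Φ r γ β) (hr : ReadLipschitz r cr) (hdir : StepDirect Φ ℓ' γ)
    (hmem : StepMemoryFn Φ γ (fun x => c * x) ω) (hsh : StepShift Φ γ src)
    (hsrc : ∀ k, src k ≤ a * ρ ^ k)
    (hrun : ∀ K, RGEqH K β (g K)) (hbox : ∀ K i, i ≤ K → 0 < g K i ∧ g K i ≤ γ)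
    (hpin : ∀ K, g K K = gIR) (hlo : EventualLowerH b γ k₀ β)
    (hwin : cr * ℓ' * ((1 + c * γ) ^ k₀ * Real.exp (2 * c * Real.sqrt (⌈c ^ 2 / (b * ε ^ 2)⌉₊ : ℝ) / Real.sqrt b))
      * (((k₀ : ℝ) + 1) * γ ^ 3 + 2 * γ / b) ≤ (1 - (1 + ε) * ω) / 2) :
    T4CauchySum.InjectedRate
      (2 * (cr * (a * (((1 + c * γ) ^ k₀ * Real.exp (2 * c * Real.sqrt (⌈c ^ 2 / (b * ε ^ 2)⌉₊ : ℝ) / Real.sqrt b))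
        * (ρ / (ρ - (1 + ε) * ω))))) / (1 - ρ))
      0 ρ (fun K j => disc (g K) (g (K + 1)) j) := by
  intro K j hj
  refine ⟨disc_nonneg _ _ _, ?_⟩
  set Λ := (1 + c * γ) ^ k₀ * Real.exp (2 * c * Real.sqrt (⌈c ^ 2 / (b * ε ^ 2)⌉₊ : ℝ) / Real.sqrt b) with hΛ
  have hΛ1 : 1 ≤ Λ :=
    one_le_mul_of_one_le_of_one_le (one_le_pow₀ (by nlinarith)) (Real.one_le_exp (by positivity))
  -- the step constants read along run A = g K (clamped beyond K)
  set C : ℕ → ℝ := fun j => c * extd (prefixOf (g K) K) j with hC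
  have hadm : Adm γ (extd (prefixOf (g K) K)) := extd_adm (prefixOf_mem_box le_rfl (hbox K))
  have hC0 : ∀ j, 0 ≤ C j := fun j => mul_nonneg hc (hadm j).1.le
  have hCj : ∀ j, j < K → C j = c * g K j := fun j hj => by simp only [hC, extd_prefixOf hj.le]
  have hbad : ∏ n ∈ (range K).filter (fun n => ε < C n), (1 + C n) ≤ Λ := by
    have e1 : (range K).filter (fun n => ε < C n) = (range K).filter (fun n => ε < c * g K n) :=
      Finset.filter_congr fun n hn => by rw [hCj n (mem_range.mp hn)]
    rw [e1, Finset.prod_congr rfl (fun n hn => by rw [hCj n (mem_range.mp (Finset.mem_filter.mp hn).1)])]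
    exact prod_exceptional_coupling_le hb hc hε (hrun K) (hbox K) hlo
  have hEnv : ∀ i j, i ≤ j → j < K → ∏ n ∈ Ico (i + 1) (j + 1), (1 + C n) ≤ Λ * (1 + ε) ^ (j - i) :=
    fun i j hij hjK => (env_le_prod_bad hC0 hε.le i j hij hjK).trans
      (mul_le_mul_of_nonneg_right hbad (pow_nonneg (by linarith) _))
  have hmemA : ∀ j (y y' : ℕ → X), j < K →
      dist (Φ j (g K j) y) (Φ j (g K j) y') ≤ ∑ m ∈ range j, C j * ω ^ (j - m) * dist (y m) (y' m) := by
    intro j y y' hj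
    rw [hCj j hj]
    exact hmem j (g K j) y y' (hbox K j hj.le).1 (hbox K j hj.le).2
  have hren := twoRunRenewal_of_scheme_runwise hdir hmemA hsh hsrc (hbox K) (hbox (K + 1))
  have hM : ∀ j i, i < j → 0 ≤ C j * ω ^ (j - i) ∧ C j * ω ^ (j - i) ≤ C j * ω ^ (j - i) :=
    fun j i _ => ⟨mul_nonneg (hC0 j) (pow_nonneg hω _), le_rfl⟩
  have hwin' : cr * Λ * (ℓ' * (((k₀ : ℝ) + 1) * γ ^ 3 + 2 * γ / b)) ≤ (1 - (1 + ε) * ω) / 2 := by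
    have e : cr * Λ * (ℓ' * (((k₀ : ℝ) + 1) * γ ^ 3 + 2 * γ / b))
        = cr * ℓ' * Λ * (((k₀ : ℝ) + 1) * γ ^ 3 + 2 * γ / b) := by ring
    rw [e]; exact hwin
  have h := (disc_le_of_twoRun_env hρ1 hω hε.le hgap ha hℓ' hcr (hrun K) (hrun (K + 1)) (hbox K)
    (hbox (K + 1)) ((hpin K).trans (hpin (K + 1)).symm)
    (betaMismatch_le_of_represents hrep hr (hbox K) (hbox (K + 1)))
    hren (fun j _ => pairDist_nonneg Φ (g K) (g (K + 1)) K j) hC0 hΛ1 hEnv hM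
    (sum_weights_le_of_eventualLower hγ hb (hrun K) (hrun (K + 1)) (hbox K) (hbox (K + 1)) hlo) hwin').1 j hj
  have h' : disc (g K) (g (K + 1)) j ≤ 2 * (cr * (a * (Λ * (ρ / (ρ - (1 + ε) * ω))))) / (1 - ρ) * ρ ^ j :=
    calc disc (g K) (g (K + 1)) j ≤ 2 * (cr * a * (Λ * (ρ / (ρ - (1 + ε) * ω)))) / (1 - ρ) * ρ ^ j := h
      _ = 2 * (cr * (a * (Λ * (ρ / (ρ - (1 + ε) * ω))))) / (1 - ρ) * ρ ^ j := by ring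
  simpa using h'

end SchemeLevel

/-! ## §6 The PRIMITIVE BOOKING of §5 (one number `ν < 1` dominating the source rate and the memory threshold
`(1 + ε)ω`; rate `(1 + ν)/2`; constant `8·cr·a·Λ/(1 − ν)²`) — the currency of `T4TwoRunClosure` §3/§6 -/

section Primitive

variable {X : Type*} [PseudoMetricSpace X] [Inhabited X]

open Literature.MathematicalPhysics.QuantumFieldTheory.Balaban1983to89.T4FlagMemoryAF (StepMemoryFn)

/-- Pure arithmetic: at the primitive rate `ρ = (1 + ν)/2` with `(1 + ε)ω ≤ ν < 1` the §5 output constant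
`2·cr·a·Λ·ρ/(ρ − (1 + ε)ω)·(1 − ρ)⁻¹` is at most `8·cr·a·Λ/(1 − ν)²` (`ρ − (1 + ε)ω ≥ (1 − ν)/2`, `ρ ≤ 1`,
`1 − ρ = (1 − ν)/2`).  Compare `T4TwoRunClosure.rateConst_le_primitive` (the box-uniform constant, no `Λ`). [folklore] -/
theorem rateConst_le_primitive_env {cr a Λ ε ω ν : ℝ} (hcr : 0 ≤ cr) (ha : 0 ≤ a) (hΛ : 0 ≤ Λ) (hε : 0 ≤ ε)
    (hω : 0 ≤ ω) (hν1 : ν < 1) (hεων : (1 + ε) * ω ≤ ν) :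
    2 * (cr * (a * (Λ * (((1 + ν) / 2) / ((1 + ν) / 2 - (1 + ε) * ω))))) / (1 - (1 + ν) / 2)
      ≤ 8 * cr * a * Λ / (1 - ν) ^ 2 := by
  have hεω : 0 ≤ (1 + ε) * ω := mul_nonneg (by linarith) hω
  have hD : (1 - ν) / 2 ≤ (1 + ν) / 2 - (1 + ε) * ω := by linarith
  have hDpos : 0 < (1 + ν) / 2 - (1 + ε) * ω := by linarith
  have h1ν : 0 < 1 - ν := by linarith
  have hq : ((1 + ν) / 2) / ((1 + ν) / 2 - (1 + ε) * ω) ≤ 2 / (1 - ν) := by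
    rw [div_le_iff₀ hDpos]
    have h2 : 0 ≤ 2 / (1 - ν) := div_nonneg (by norm_num) h1ν.le
    have h3 : 2 / (1 - ν) * ((1 - ν) / 2) = 1 := by
      field_simp
    have h4 : (1 : ℝ) ≤ 2 / (1 - ν) * ((1 + ν) / 2 - (1 + ε) * ω) := by
      calc (1 : ℝ) = 2 / (1 - ν) * ((1 - ν) / 2) := h3.symm
        _ ≤ 2 / (1 - ν) * ((1 + ν) / 2 - (1 + ε) * ω) := mul_le_mul_of_nonneg_left hD h2
    linarith
  have hnum : 2 * (cr * (a * (Λ * (((1 + ν) / 2) / ((1 + ν) / 2 - (1 + ε) * ω)))))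
      ≤ 2 * (cr * (a * (Λ * (2 / (1 - ν))))) := by
    have h1 := mul_le_mul_of_nonneg_left hq hΛ
    have h2 := mul_le_mul_of_nonneg_left h1 ha
    have h3 := mul_le_mul_of_nonneg_left h2 hcr
    linarith
  have e0 : 1 - (1 + ν) / 2 = (1 - ν) / 2 := by ring
  rw [e0]
  calc 2 * (cr * (a * (Λ * (((1 + ν) / 2) / ((1 + ν) / 2 - (1 + ε) * ω))))) / ((1 - ν) / 2)
      ≤ 2 * (cr * (a * (Λ * (2 / (1 - ν))))) / ((1 - ν) / 2) := div_le_div_of_nonneg_right hnum (by linarith)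
    _ = 8 * cr * a * Λ / (1 - ν) ^ 2 := by
      field_simp
      ring

/-- **NODE U2's OUTPUT FED RUN-WISE, PRIMITIVE BOOKING (count dictionary).**  As
`T4TwoRunClosure.injectedRate_of_fullScheme_primitive_af` — ONE number `ν < 1` dominating the source rate `θ` and the
memory THRESHOLD, rate `(1 + ν)/2` — with the threshold now `(1 + ε)ω ≤ ν` for ANY `ε > 0` (NO `γ`, NO `c`: the
memory constant per unit coupling is not measured against `ν`), the memory hypothesis P1's coupling-weighted
`StepMemoryFn Φ γ (c·) ω` BY NAME, the window `2·cr·ℓ′·Λ·((k₀+1)γ³ + 2γ/b) ≤ 1 − (1 + ε)ω` and the constant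
`8·cr·a·Λ/(1 − ν)²`, `Λ = (1 + cγ)^{k₀ + ⌈c²/(bε²)⌉}` (`injectedRate_of_fullScheme_twoRun_afTail` +
`rateConst_le_primitive_env` + `T4TwoRunClosure.injectedRate_mono_const`).  HONEST LIMITS as in §5: every scheme shape
UNPRINTED, runs / pin BINDERS, `EventualLowerH` the β sub-cell's undelivered input; the window is a smallness condition
on `γ` given `(c, b, k₀, ε, cr, ℓ′, ω)`, NOT uniformly weaker than the box-uniform one; rung (B)+1 finite-T⁴
bookkeeping, NOT summit progress. [cite: Balaban1987RG1, (0.20) p.256 and Thm 2 p.259] -/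
theorem injectedRate_of_fullScheme_primitive_afTail {β : HBeta} {Φ : ℕ → ℝ → (ℕ → X) → X} {r : X → ℝ}
    {src : ℕ → ℝ} {ℓ' c ω γ cr a θ ν b ε : ℝ} {k₀ : ℕ} (g : ℕ → ℕ → ℝ) (gIR : ℝ)
    (hγ : 0 < γ) (hb : 0 < b)
    (hℓ' : 0 ≤ ℓ') (hc : 0 ≤ c) (hω : 0 ≤ ω) (hcr : 0 ≤ cr) (ha : 0 ≤ a) (hθ : 0 ≤ θ) (hε : 0 < ε)
    (hν1 : ν < 1) (hθν : θ ≤ ν) (hεων : (1 + ε) * ω ≤ ν)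
    (hrep : Represents Φ r γ β) (hr : ReadLipschitz r cr) (hdir : StepDirect Φ ℓ' γ)
    (hmem : StepMemoryFn Φ γ (fun x => c * x) ω) (hsh : StepShift Φ γ src)
    (hsrc : ∀ k, src k ≤ a * θ ^ k)
    (hrun : ∀ K, RGEqH K β (g K)) (hbox : ∀ K i, i ≤ K → 0 < g K i ∧ g K i ≤ γ)
    (hpin : ∀ K, g K K = gIR) (hlo : EventualLowerH b γ k₀ β)
    (hwin : 2 * (cr * ℓ' * (1 + c * γ) ^ (k₀ + ⌈c ^ 2 / (b * ε ^ 2)⌉₊) * (((k₀ : ℝ) + 1) * γ ^ 3 + 2 * γ / b))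
      ≤ 1 - (1 + ε) * ω) :
    T4CauchySum.InjectedRate (8 * cr * a * (1 + c * γ) ^ (k₀ + ⌈c ^ 2 / (b * ε ^ 2)⌉₊) / (1 - ν) ^ 2) 0
      ((1 + ν) / 2) (fun K j => disc (g K) (g (K + 1)) j) := by
  have hgap : (1 + ε) * ω < (1 + ν) / 2 := by linarith
  have hρ1 : (1 + ν) / 2 < 1 := by linarith
  have hρ0 : 0 ≤ (1 + ν) / 2 := by
    have : 0 ≤ (1 + ε) * ω := mul_nonneg (by linarith) hω
    linarith
  have hsrc' : ∀ k, src k ≤ a * ((1 + ν) / 2) ^ k := fun k =>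
    (hsrc k).trans (mul_le_mul_of_nonneg_left (pow_le_pow_left₀ hθ (by linarith) k) ha)
  have hwin' : cr * ℓ' * (1 + c * γ) ^ (k₀ + ⌈c ^ 2 / (b * ε ^ 2)⌉₊) * (((k₀ : ℝ) + 1) * γ ^ 3 + 2 * γ / b)
      ≤ (1 - (1 + ε) * ω) / 2 := by linarith
  have hΛ : 0 ≤ (1 + c * γ) ^ (k₀ + ⌈c ^ 2 / (b * ε ^ 2)⌉₊) := pow_nonneg (by nlinarith) _
  exact injectedRate_mono_const
    (injectedRate_of_fullScheme_twoRun_afTail g gIR hγ hb hρ1 hℓ' hc hω hcr ha hε hgap hrep hr hdir hmem hsh hsrc'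
      hrun hbox hpin hlo hwin')
    (rateConst_le_primitive_env hcr ha hΛ hε.le hω hν1 hεων) hρ0

/-- **NODE U2's OUTPUT FED RUN-WISE, PRIMITIVE BOOKING (sum dictionary).**  As
`injectedRate_of_fullScheme_primitive_afTail` with `Λ = (1 + cγ)^{k₀}·exp(2c√⌈c²/(bε²)⌉/√b)`
(`injectedRate_of_fullScheme_twoRun_afTail_sum`).  Same HONEST LIMITS; NOT summit progress.
[cite: Balaban1987RG1, (0.20) p.256 and Thm 2 p.259] -/
theorem injectedRate_of_fullScheme_primitive_afTail_sum {β : HBeta} {Φ : ℕ → ℝ → (ℕ → X) → X} {r : X → ℝ}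
    {src : ℕ → ℝ} {ℓ' c ω γ cr a θ ν b ε : ℝ} {k₀ : ℕ} (g : ℕ → ℕ → ℝ) (gIR : ℝ)
    (hγ : 0 < γ) (hb : 0 < b)
    (hℓ' : 0 ≤ ℓ') (hc : 0 ≤ c) (hω : 0 ≤ ω) (hcr : 0 ≤ cr) (ha : 0 ≤ a) (hθ : 0 ≤ θ) (hε : 0 < ε)
    (hν1 : ν < 1) (hθν : θ ≤ ν) (hεων : (1 + ε) * ω ≤ ν)
    (hrep : Represents Φ r γ β) (hr : ReadLipschitz r cr) (hdir : StepDirect Φ ℓ' γ)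
    (hmem : StepMemoryFn Φ γ (fun x => c * x) ω) (hsh : StepShift Φ γ src)
    (hsrc : ∀ k, src k ≤ a * θ ^ k)
    (hrun : ∀ K, RGEqH K β (g K)) (hbox : ∀ K i, i ≤ K → 0 < g K i ∧ g K i ≤ γ)
    (hpin : ∀ K, g K K = gIR) (hlo : EventualLowerH b γ k₀ β)
    (hwin : 2 * (cr * ℓ' * ((1 + c * γ) ^ k₀ * Real.exp (2 * c * Real.sqrt (⌈c ^ 2 / (b * ε ^ 2)⌉₊ : ℝ) / Real.sqrt b))
      * (((k₀ : ℝ) + 1) * γ ^ 3 + 2 * γ / b)) ≤ 1 - (1 + ε) * ω) :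
    T4CauchySum.InjectedRate
      (8 * cr * a * ((1 + c * γ) ^ k₀ * Real.exp (2 * c * Real.sqrt (⌈c ^ 2 / (b * ε ^ 2)⌉₊ : ℝ) / Real.sqrt b))
        / (1 - ν) ^ 2) 0 ((1 + ν) / 2) (fun K j => disc (g K) (g (K + 1)) j) := by
  have hgap : (1 + ε) * ω < (1 + ν) / 2 := by linarith
  have hρ1 : (1 + ν) / 2 < 1 := by linarith
  have hρ0 : 0 ≤ (1 + ν) / 2 := by
    have : 0 ≤ (1 + ε) * ω := mul_nonneg (by linarith) hω
    linarith
  have hsrc' : ∀ k, src k ≤ a * ((1 + ν) / 2) ^ k := fun k =>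
    (hsrc k).trans (mul_le_mul_of_nonneg_left (pow_le_pow_left₀ hθ (by linarith) k) ha)
  have hwin' : cr * ℓ' * ((1 + c * γ) ^ k₀ * Real.exp (2 * c * Real.sqrt (⌈c ^ 2 / (b * ε ^ 2)⌉₊ : ℝ) / Real.sqrt b))
      * (((k₀ : ℝ) + 1) * γ ^ 3 + 2 * γ / b) ≤ (1 - (1 + ε) * ω) / 2 := by linarith
  have hΛ : 0 ≤ (1 + c * γ) ^ k₀ * Real.exp (2 * c * Real.sqrt (⌈c ^ 2 / (b * ε ^ 2)⌉₊ : ℝ) / Real.sqrt b) :=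
    mul_nonneg (pow_nonneg (by nlinarith) _) (Real.exp_pos _).le
  exact injectedRate_mono_const
    (injectedRate_of_fullScheme_twoRun_afTail_sum g gIR hγ hb hρ1 hℓ' hc hω hcr ha hε hgap hrep hr hdir hmem hsh
      hsrc' hrun hbox hpin hlo hwin')
    (rateConst_le_primitive_env hcr ha hΛ hε.le hω hν1 hεων) hρ0

end Primitive

end Literature.MathematicalPhysics.QuantumFieldTheory.Balaban1983to89.T4TwoRunAfTail
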